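import Mathlib
import HarnessLib
import HarnessLib.Audit
import Summits.BirchSwinnertonDyer.Statement
import Summits.BirchSwinnertonDyer.BirchSwinnertonDyer.Theorems.ByReductionTypeAtTwoSupersingularInputs
import Summits.BirchSwinnertonDyer.BirchSwinnertonDyer.Theorems.Rank1ResidualX5TwoDefs
import Literature.NumberTheory.EllipticCurves.BDKim2009.SignedSelmerCongruentLambdaInvariant
import Summits.BirchSwinnertonDyer.Rank1Residual.WAll.TargetAtTwoThetaSlices
import Literature.NumberTheory.EllipticCurves.GreenbergVatsal2000.NonPrimitivePAdicLFunction
import Literature.NumberTheory.EllipticCurves.GreenbergVatsal2000.ResidualSelmerGroups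
import Literature.NumberTheory.EllipticCurves.Greenberg1999.CasselsSurjectivityH1Sigma
import Literature.NumberTheory.EllipticCurves.Greenberg1999.NoProperFiniteIndexSubmoduleH1Sigma
import Literature.NumberTheory.EllipticCurves.Greenberg1999.H1SigmaCorankBound
import Literature.NumberTheory.EllipticCurves.Greenberg1999.LocalQuotientControlSurjective
import Literature.NumberTheory.EllipticCurves.Greenberg1999.H1SigmaInftyRankOne
import Literature.NumberTheory.EllipticCurves.Kato2004.EulerSystemBoundFineSelmerTwoContragredient
import Summits.BirchSwinnertonDyer.BirchSwinnertonDyer.Theorems.PublishedInputsOfNewform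
import Literature.NumberTheory.EllipticCurves.EichlerShimuraOptimalQuotientLattice
import Literature.NumberTheory.EllipticCurves.ModularJacobianTorsionHeckeSelfDual
import Literature.NumberTheory.EllipticCurves.ModularJacobianModTwoMultiplicityOne
import Literature.NumberTheory.EllipticCurves.SupersingularModPDecompositionImage
import Summits.BirchSwinnertonDyer.BirchSwinnertonDyer.Theorems.ThetaPartnerAtTwoSignedMainConjectureCMTwoRankZeroKatoDescentSocketDefs
import Summits.BirchSwinnertonDyer.BirchSwinnertonDyer.Theorems.ThetaPartnerAtTwoSignedKatoUpToAtTwoLayerPairingCompat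
import Literature.NumberTheory.EllipticCurves.Rank1Residual.Predicates
import Literature.NumberTheory.EllipticCurves.PAdicBSD
import Literature.NumberTheory.EllipticCurves.PlusMinusPAdicLFunction
import Literature.NumberTheory.EllipticCurves.CuspFormLFunction
import Summits.BirchSwinnertonDyer.Rank1Residual.Supersingular.KobayashiMainConjecture
import Literature.NumberTheory.EllipticCurves.Kato2004.EulerSystemTatePairingValuesTwo
import Summits.BirchSwinnertonDyer.BirchSwinnertonDyer.Theorems.ManinLocalTwoThreeAbbesUllmoCesnaviciusManinConstant
import HarnessLib.Audit.Status.Attr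

/-!
Route: ThetaPartnerAtTwo

# Route ThetaPartnerAtTwo — Signed main conjecture at 2 transported from a CM partner with 2 inert

It suffices to show X = «the `+` main conjecture of Kobayashi at p = 2 TRANSPORTS along a mod-2
congruence from a CM
partner»: for E/ℚ non-CM of analytic rank 0, good supersingular at 2 with a₂ = 0, and A/ℚ a CM curve
good supersingular
at 2 (2 inert in the CM field K, a₂(A) = 0) with E[2] ≅ A[2] as Galois modules, (K2) μ⁺(A) = 0 and
Char X⁺(A/ℚ_∞) =
(L₂⁺(A)) hold (GL₁: elliptic units of K at the inert prime 2), (K1) these transport to E given (K3)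
one Kato-side
divisibility for E up to a power of 2, and (K4) Kobayashi 1.2 / Kim 3.15 control at 2 turns Char
X⁺(E) = (L₂⁺(E)) into
BSD₂(E) through the tree's door `bsdp_two_of_kobayashiMainConjecture_two_of_frobeniusTrace_eq_zero`.
X = K1 ∧ K2 ∧ K3 ∧ K4
on the THETA HABITAT; the complement of the habitat inside row 1 (`NonCMAtTwo`: non-CM, r ≤ 1, p =
2) is ONE declared
residual crux `OffThetaHabitatAtTwo` (ordinary / multiplicative / additive / rank 1 / a₂ = ±2 / no
CM partner), attacked by
route-BirchSwinnertonDyer-ByReductionTypeAtTwo. No card realised (novel-route seat bsd-wall-p2, lens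
(i) IMC at p = 2).
Lean: `SignedTransportAtTwo ∧ SignedMainConjectureCMTwo ∧ SignedKatoDivisibilityUpToAtTwo ∧
SignedControlAtTwo ∧ OffThetaHabitatAtTwo`

## Assembly
On the habitat the deciding theorem `closes` (glue.lean, sorry-free, rc 0) picks the CM partner A
from the habitat hypothesis,
gets μ⁺(A) = 0 ∧ MC⁺(A) from K2, MC⁺(E) from K1 fed with K3, and BSD₂(E) from the tree door
`Theorems.bsdp_two_of_kobayashiMainConjecture_two_of_frobeniusTrace_eq_zero` with K4's two control
inputs and the three PUB
supports (L(E,1) ≠ 0 from r_an = 0 via `analyticRank_eq_zero_iff_holds`); off the habitat it applies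
the residual. Pure logic
plus one existing door (the deciding theorem is `closes`; the Assembly item below is its statement).

CLOSES_TARGET: closes rung W-ALL/1.hab of BirchSwinnertonDyer: Summit.BirchSwinnertonDyer.WAllNonCMAtTwoThetaHabitat (D-0061; not the summit Statement) — the deciding theorem of this route concludes that registered leaf instead of the Statement decl `BirchSwinnertonDyer` (class rung: servable and labelled, never counted as concluding the summit Statement).

Rationale: WHY THIS LINE. On the good-supersingular block at 2 the residual representation E[2] is
automatically irreducible (`P2.irr_two_of_goodSS_two`)
with image S₃ = Ind_K χ̄ for K = ℚ(√Δ_E), and Δ_min ≡ 5 (mod 8) forces 2 INERT in K, ρ̄|D₂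
irreducible: this is exactly the
situation in which a CM object of K can be congruent to E mod 2 with the SAME supersingular local
type (a₂ = 0, Honda type
X² + 2, same ± local condition), so Greenberg–Vatsal transport (GreenbergVatsal2000 Thm 1.4; signed
version BDKim2009 Cor 2.13,
analytic side Vatsal1999 / EmertonPollackWeston2006) has a μ = 0 SOURCE whose main conjecture is
GL₁: Rubin1991 /
PollackRubin2004, and at p = 2 the two-variable main conjecture for K is now in print for EVERY
prime (Johnson-Leung–Kings,
used by BurungaleFlach2024 §4 Thm 4.1 = arXiv:2206.09874 p.17, which proves BSD for CM rank-0 curves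
at every p incl. 2 —
tree fact `bsdTriple_of_hasCM_of_L_one_ne_zero`). Imported: GL₁ Iwasawa theory of imaginary
quadratic fields (elliptic
units) and congruence transport; the prior p = 2 routes use neither (ByReductionTypeAtTwo: per-type
halves, no transport;
TwoAdicConverse: rank axis through an auxiliary K with 2 SPLIT; the 2adic card
dihedral-rigidity-two: ORDINARY Matsuno
transport between non-CM curves, where «the CM-anchor variant is dead on arrival» because an
ordinary CM member needs 2 split).
The negatives index has no statement on signed objects at 2. TARGET SINCE REV 11: `closes` concludes
the registered W-ALL slice leaf `Summit.BirchSwinnertonDyer.WAllNonCMAtTwoThetaHabitat` (ty-1 g6,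
`WAll/TargetAtTwoThetaSlices.lean`: row 1 `NonCMAtTwo` sliced along the theta habitat, exact glue
`nonCMAtTwo_iff_thetaHabitat_offThetaHabitat`) from K1–K4 + the three PUB supports, with NO residual
binder; the complement leaf `WAllNonCMAtTwoOffThetaHabitat` (≡ the former residual item 20334 by
rfl) is rung-K4 / ByReductionTypeAtTwo territory and re-assembles to row 1 by ty-2's landed
`Rank1Residual.WAll.nonCMAtTwo_of_thetaHabitat_of_offThetaHabitat_r0Partner` (p514468) — so the old
Assembly (20311, → NonCMAtTwo) stays provable in one line. HONEST FRAMING (J pre-reading 05:48Z;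
numbers in NUMBERS): the attacked conjunct is a THIN but infinite slice — as a class, every non-CM
curve of analytic rank 0, good supersingular at 2 with a₂ = 0, whose 2-division field is the field
M_d of a CM curve good supersingular at 2 (d ∈ {3, 11, 19, 43, 67, 163}; for d = 3 the condition is
just ℚ(√Δ_min) = ℚ(√−3)); inside the X5 block of record it is 19 of the 208 good-ss a₂ = 0 classes
(9.1 %), ≤ 0.40 % of the 4 730 row-1 r0 residue cells, 0 of the 20 r1 cells. The route is NESTED in
K4's target, not a re-dress of K4 (tribunal T1 06:38:30Z: no TP2 crux implies or is implied by K4's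
open supersingular crux 19097 or its ordinary halves; the four mechanism cruxes are
crux-incomparable with S): if 19097 (SupersingularRankZeroAtTwo, per-curve Coleman road) closes,
K1–K4 are mooted on the habitat; what this line buys that the Coleman road does not is a μ = 0
SOURCE (GL₁ elliptic units at the inert prime 2) and an INTEGRAL main conjecture on the habitat with
no per-curve certificate, i.e. a class theorem rather than a class kit. ARCHIMEDEAN SIDE (new at rev
5): at p = 2 congruence transport carries a hypothesis at the real place — Matsuno2008 Thm 4.2 (p.
413: «If p = 2 … we also need the condition for v ∈ Σ_+»): when Δ_E > 0 the isomorphism φ : E[2] →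
A[2] must map C_{E,∞}[2] (the minimal-abscissa 2-torsion point, = 2-torsion of (E(ℂ)[2^∞]⁻)_div, =
the Kummer line of E(ℝ)/2) to C_{A,∞}[2]; when Δ < 0, Σ_+ = ∅ and there is no condition (H¹(ℝ,
E[2^k]) = 0). On the theta habitat K = ℚ(√Δ_E) = ℚ(√Δ_A) is the imaginary CM field, so Δ < 0 on both
sides and the line sits in the condition-free case; PACKETS-X5SS-v1 (ba22f7da916d4685) shows on 291
certified pairs of the whole X5 block that this condition is exactly what separates success (259/259
pairs) from failure (31/32) of signed λ-transport at 2, independently of a₂.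

RANKED CRUXES. K1 NET (2026-08-28, kernel p631563
`MazurTateCongruenceAtTwoR.mazurTateCongruenceAtTwoTop_of_publishedInputsHeckeAtTwo`): the rank-2
crux MazurTateCongruenceAtTwoTop (25797, SPLIT) is reduced to the PUB⁵ HOLD bundle
PublishedInputsHeckeAtTwo (27435) ALONE —
OfPub posture like K1P 25785; split glue 27437 CLOSED·proved; the shared node CuspSpanEvenAtTwoOdd
(27436) is CLOSED·proved (2026-08-28T15:07:23Z, p643713 over the all-odd-levels theorem
`SignedMuAtTwo.Rows.cuspSpanEvenAtTwo_oddLevel`), so 25797 ⟸ 27435 alone via glue 27437.  K2 KZ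
(2026-08-28, director-bsd GO 15:12:57Z; lead tp2-p2 g11 KZ-DESIGN-g11.md §4): the rank-3 crux
SignedMainConjectureCMTwoRankZeroOfPubOfFlat (26471, binder hCMPf, SPLIT) is reduced to the PUB HOLD
bundle KatoZetaErlKSideCMAtTwoSupply (stmt-BirchSwinnertonDyer-28306: Kato 2004 Thm 12.5/§15 for the
CM newform f_A at 2, Kobayashi 2003 (8.23), Johnson-Leung–Kings 2011 Thm 5.7 §7.2) through the
certificate item SignedMainConjectureCMTwoRankZeroOfPubOfFlatOfKZ (stmt-BirchSwinnertonDyer-28307,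
closer p638949) and the split glue (stmt-BirchSwinnertonDyer-28308); the K2 column's open research
content is the declared residual AnalyticMuFlatCMTwoRankZero (26470, FLAT = Perrin-Riou μ^± = 0 at 2
on the rank-0 CM members) alone. Earlier ranking text follows unchanged.
#2 SignedTransportAtTwo (crux; rev 7 = stmt 20333, FRAMED) — Signed Greenberg–Vatsal
transport at p = 2: for (E, A) on the theta habitat with E[2] ≅ A[2] (A CM of analytic rank 0, good
supersingular at 2, a₂ = 0), GIVEN a newform f_A of A, its period ratio ϖ_A (ϖ_A·Ω_A = Ω⁺_{f_A}) and
a Pollack pair (L♯_A, L♭_A) of f_A at 2: μ⁺(A) = 0 with X⁺(A) torsion, Kobayashi's `+` main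
conjecture for A at 2, and the Kato-side divisibility for E up to a power of 2 imply Kobayashi's `+`
main conjecture for E at 2 (algebraic λ/μ transport à la BDKim2009 Cor 2.13, analytic congruence of
Pollack's L⁺ à la Vatsal/EPW with multiplicity one mod 2, then equal invariants + one divisibility ⇒
equal ideals). [difficulty: XL] (why it might fail: Kim 2009 Cor 2.13 / EPW are printed for odd p;
at 2 transport needs Matsuno's archimedean condition φ(C_∞[2]) = C′_∞[2] when Δ > 0 (31/32 violating
X5 pairs fail, PACKETS-X5SS-v1) — vacuous on the habitat (Δ < 0) — and the signed local condition at
2 / T+2 ∣ g (Kurihara–Otsuki) may still force a 2-power the algebraic side does not see.)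
[GreenbergVatsal2000, BDKim2009, EmertonPollackWeston2006, Vatsal1999, Kobayashi2003,
arXiv:math/0612317, KuriharaOtsuki2006, Matsuno2008]
#3 SignedMainConjectureCMTwoRankZero (crux; rev 13 = stmt 20312 — the `hCM` binder of `closes` since
rev 13, consumed only at the rank-0 CM PARTNER A: `hCM A hAcm hAr hAss hAa`; rank-0 sufficiency
kernel-certified by p518558 `signedMainConjectureCMTwo_rankZero_of_signedMainConjectureCMTwo`) — For
every CM curve A/ℚ of ANALYTIC RANK 0 with good supersingular reduction at 2 and a₂ = 0 (2 inert in
the CM field): X⁺(A/ℚ_∞) is Λ-torsion with μ⁺ = 0 for every cyclotomic top-generator pair, and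
Kobayashi's `+` main conjecture holds at 2 (Néron-normalised, exact) — Pollack–Rubin 2004 Thm 7.3
read at (p, ε) = (2, +), where L(A,1) ≠ 0 pins the constant term of every generator of char X⁺(A)
(BSD₂(A) for CM rank 0: Burungale–Flach 2024, tree fact bsdTriple_of_hasCM_of_L_one_ne_zero), so ONE
divisibility (the elliptic-unit / Eisenstein half `KobayashiLowerDivisibility A 2 1`) + Kim's
control at 2 + torsion + analytic μ = 0 give the whole statement (tp2-p2 g1: p518019
`signedMainConjectureCMTwo_at_rankZero_of_lowerDivisibility`, p519461
`signedMainConjectureCMTwo_rankZero_of_parts`, p523402 period unit at 2 + Literature fact p522394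
`realPeriodRat_eq_unit_mul_plusPeriod_two`; skeleton `rankzero` on 20312, 6 stubs, load-bearing
stub_lowerDivisibilityCMTwo). [difficulty: L] (why it might fail: PollackRubin2004 Thm 7.3 is
printed for p > 2 (± decomposition of local units); at the inert prime 2 the elliptic-unit index or
the period ratio ϖ_A may carry a 2-power on some rank-0 CM class (μ⁺ > 0, or char X⁺ = (2^k·L♭), k ≠
0); analytic μ = 0 is kit-certified on 25 anchors only.) [PollackRubin2004, Rubin1991,
BurungaleFlach2024, arXiv:2206.09874, Pollack2003, KuriharaOtsuki2006, Kobayashi2003, BDKim2013]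
#3′ SignedMainConjectureCMTwo (ASIDE since rev 14 — banked context, never staffed, not counted; rev
0–12 the `hCM` binder = stmt 20307): the same statement for EVERY CM curve A with good supersingular
reduction at 2 and a₂ = 0, positive analytic rank included — strictly stronger than #3 and not
needed by `closes` (the positive-rank CM classes, Rubin's two-variable side, never enter the habitat
argument); decl kept verbatim because p509213 (`signedMainConjectureCMTwo_iff`,
`…_of_structure_of_mainConjecture`), p518558 and
Cruxes/SignedMainConjectureCMTwo/Lines/rankzero.lean name it. #4 SignedKatoDivisibilityUpToAtTwo
(crux) — On the habitat (E non-CM, r_an = 0, good supersingular at 2, a₂ = 0): for every signed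
Selmer dual datum, Char X⁺(E/ℚ_∞) = (g) with g·h = 2^m·ϖ·L⁺ for some h ∈ Λ and m ≥ 0 — Kato's
Euler-system divisibility through Kobayashi's `+` Coleman map at p = 2, up to a power of 2 (E[2]
absolutely irreducible is automatic). [difficulty: L] (why it might fail: Kato 2004 Thm 12.5 and
Kobayashi Thm 1.3/§8 are printed for p odd; at 2 the signed Coleman map and the
Euler-system-to-Selmer bound need H¹(ℚ₂(μ_2^∞), T) control where the 2-adic image (index in GL₂(ℤ₂),
RZB) intervenes.) [Kato2004Asterisque, Kobayashi2003, Sprung2017]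
#5 SignedControlAtTwo (crux) — On the habitat: X⁺(E/ℚ_∞) is finitely generated over Λ = ℤ₂⟦T⟧
(Kobayashi Thm 1.2 at 2) and, when torsion with Char = (g) and Sel finite, g(0) ∼ 2^(v₂ ∏
c_ℓ)·#Sel_2^∞(E/ℚ) (B. D. Kim 2013 Cor 3.15 at 2) — the two control inputs of the tree's a₂ = 0 door
at 2. [difficulty: M] (why it might fail: Kim 2013 Cor 3.15 is printed for odd p; at 2 the local
Euler-characteristic term (Tamagawa factor at 2, H¹(ℚ₂, Ê) and the ± condition at the bottom layer)
may contribute an extra 2-power to g(0).) [Kobayashi2003, BDKim2013]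
#6 OffThetaHabitatAtTwo (ASIDE since rev 11 — banked context, never staffed, not counted; rev 7–10
the declared residual): row 1 off the theta habitat — every non-CM E of analytic rank ≤ 1 that is
NOT (rank 0 ∧ good supersingular at 2 ∧ a₂ = 0 ∧ 2-congruent to a CM curve of analytic rank 0, good
supersingular at 2 with a₂ = 0) satisfies BSD₂ (rev 7 = stmt 20334); carried by
route-BirchSwinnertonDyer-ByReductionTypeAtTwo (ordinary / multiplicative / additive / rank one / a₂
= ±2) and booked as the registered leaf `Summit.BirchSwinnertonDyer.WAllNonCMAtTwoOffThetaHabitat`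
(rfl-equal) — complement of the target leaf, not attacked here and no longer a binder of `closes`.
[difficulty: open-problem] (why it might fail: it contains BSD₂ for every non-CM rank-1 curve and
every additive-at-2 curve — open; it is the declared residual conjunct of row 1, exactly as hard as
row 1 minus the habitat.) [Kato2004Asterisque, GreenbergVatsal2000, Matsuno2008]
#9 ModularParametrizationSupply (support) — modularity — a modular parametrisation datum exists for
every E/ℚ (PUB; same decl as ByReductionTypeAtTwo's). [difficulty: provable-now]
[BreuilConradDiamondTaylor2001]
#9 EntireLFunctionRat (support) — L(E,s) is entire and r_an is its order at s = 1 (PUB; same decl as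
ByReductionTypeAtTwo's). [difficulty: provable-now] [BreuilConradDiamondTaylor2001]
#9 RankEqAnalyticRankLeOne (support) — Gross–Zagier–Kolyvagin: r_an ≤ 1 ⇒ rank = r_an and Ш finite
(PUB; same decl as ByReductionTypeAtTwo's). [difficulty: provable-now] [Kolyvagin1990,
GrossZagier1986]

TWO-LAYER PLAN. SignedTransportAtTwo ⇐ (algebraic: μ⁺/λ⁺ transport = Kim 2009 Cor 2.13 at p = 2) →
(analytic: μ/λ of imprimitive L₂⁺ congruent
mod 2, Vatsal/EPW at 2 with Kilford–Wiese multiplicity one) → (closing: equal λ, μ = 0 both sides +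
one divisibility ⇒ equal
ideals in Λ) → SignedTransportAtTwo — the whole Λ-algebra layer of this plan is LANDED (tp2-p1:
p509603 unit-of-invariants, p511479 closing lemma, p512985 class-level bridge
`Theorems.SignedTransportAtTwo.kobayashiMainConjecture_two_of_signedTransportBinders`: K1 ⇐ Kμ2 +
Kλ2 + V2 + torsion of X⁺(E) at 2, 0 sorry). SignedMainConjectureCMTwo ⇐ (Rubin/JLK two-variable MC
at 2 restricted to the cyclotomic
line) → (± decomposition of local units at the inert prime 2, Pollack–Rubin §§4–6 at p = 2) →
SignedMainConjectureCMTwo.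

KILL CRITERIA. (i) [STATUS: RUN 2026-08-27T08:22Z as kit job j273215 (ENGINE-2 v2 on packet
6a386523e5d59a1e, inputs sha-matched, run by cell bsd-2adic's tower-eng seat): NOT KILLED — 24/24
predicted (λ♯, λ♭) pairs confirmed EXACTLY (361a1 = (4,1), 3249a1 = (6,3), 1849a1 = (2,3), 26569a1 =
(2,9), … = 48/48 sign-invariants), μ♯ = μ♭ = 0 CERTIFIED on 25/25 rows, all STABLE, Mazur–Tate law
25/25, [0]⁺ = L(A,1)/Ω⁺ ≠ 0 on all ten rank-0 partners; and TWO-ENGINE on 9/25 rows (cell bsd-2adic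
engine1.json § ss = SF2-ALL, kit j129299, msfromell modular symbols, a disjoint code path: 19a1,
27a, 121b1, 225a1, 361a1 = (4,1), 1089a1, 1089e1, 1849a1 = (2,3), 3249a1 = (6,3) — 9/9 agree, λ(θ_n)
vectors identical); memo KIT-RESULT-TP2-CM-ANCHORS-v1.md (+ addendum) 48f9c0a0e3a2239c = evidence on
20333/20307.] THE ONE KIT JOB (J-accepted cheapest falsifier): ENGINE-2 (eng2/afe2_engine.gp)
readings of the CM anchors — predicted (λ♯, λ♭, μ♯, μ♭)(361a1) = (4, 1, 0, 0) (reached independently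
from 19a1, 282093g1, 455221c1 by the transport law), (1849a1) = (2, 3, 0, 0) (from 35131b1,
434429c1), (26569a1) = (2, 9, 0, 0) (from 132845b1), A_c : y² + y = x³ + c for c ∈ {30, 1, 90, 10,
−15, 4032, 4290, 8} as tabulated in HABITAT-CENSUS-TP2-v1.md §6, and — since rev 7 the partner USED
by `closes` has analytic rank 0 — the RANK-0 twists of HABITAT-CENSUS-TP2-v1.1 (8f55ee00fd12ff8f)
with transport-law predictions (λ♯, λ♭) = 3249a1 (6, 3) [= 361a1^(−3), partner of
19a1/282093g1/455221c1], 16641e1 (4, 5), 239121b1 (4, 11), 1089e1 (2, 1), 11025d1 (2, 1), 477603bg1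
(9, 10), and out of Cremona range 741321·tw7 (2, 1), 783225·tw5 (8, 5), 4969107·tw13 (11, 4),
73596627·tw13 (19, 4), all μ = 0 — ONE ENGINE-2 job, input packet KIT-INPUT-TP2-CM-ANCHORS-v1.md
(6a386523e5d59a1e, 25 rows, job dir kit/tp2cm/): a λ-mismatch refutes SignedTransportAtTwo's
mechanism (close: the CM-newform variant is then pointless); μ > 0 at a CM anchor refutes
SignedMainConjectureCMTwo as typed (close refuted:SignedMainConjectureCMTwo unless a 2^k-twisted
restatement survives). (ii) Any CONFLICT inside a congruence packet with Δ < 0 (two habitat curves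
with the same 2-division field predicting different partner invariants, an observed partner reading
off the prediction, or any Δ < 0 pair of the block violating λ^ε(E) + Σδ_E = λ^ε(E′) + Σδ_E′)
refutes the transport law — STATUS rev 5 (PACKETS-X5SS-v1.md ba22f7da916d4685, 84 exact packets over
the whole X5 good-ss block): 0 violations on all 223 Δ < 0 pairs with both members read (446/446
sign-tests; the habitat pairs are a subset) and on the 36 Δ > 0 pairs satisfying Matsuno's Σ_+ line
condition (72/72); 31 of the 32 Δ > 0 pairs violating the line condition fail (55/64 sign-tests) —
these are NOT kills of this route (off habitat, hypothesis of Matsuno2008 Thm 4.2 violated) but the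
refutation set for any UNMARKED transport at 2 elsewhere. (iii) A habitat curve with Char X⁺ ⊉ (2^m
L⁺) for all m refutes SignedKatoDivisibilityUpToAtTwo. (iv) Proved elsewhere:
SupersingularRankZeroAtTwo (stmt 19097) moots K1–K4 on the habitat (supersession, not refutation).

NOT DECOMPOSED YET. The analytic congruence of Pollack's L⁺ at 2 (period normalisation mod 2, Ihara
/ multiplicity one at 2) and the Λ-algebra closing lemma (equal λ, μ = 0 both sides + one
divisibility ⇒ equal ideals) — layer-2 children / skeleton stubs of SignedTransportAtTwo, not items.
SKELETON REGISTERED AT REV 7 on 20333 (v1, SUPERSEDED 2026-08-27T09:29Z by v3 below): line `bridge`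
(lines/SignedTransportAtTwo_bridge.lean a980edbc54a87cf1, composition through the landed bridge
p512985): stub_mu2 (Kim Cor 2.13 μ-half at 2), stub_lam2 (λ-half at 2 with an admissible S₀),
stub_V2 (LOAD-BEARING: analytic congruence of the Néron-normalised signed 2-adic L-functions along
E[2] ≅ A[2] — no refereed source at any p), stub_torsion2 (Kobayashi 1.2 torsion half at 2 for E;
reducible to bottom-layer ± control at 2 via
`Theorems.signedSelmerDual_isTorsion_two_of_finite_invariants`, the same open input as
ByReductionTypeAtTwo 19097 stub_zeroSignedEulerChar); finite generation is the tree theorem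
`Kobayashi2003.SignedSelmerDualData.moduleFinite`. RESHAPE IN PROGRESS (lead tp2-p1 g1, 2026-08-27):
LANDED p516564 `Theorems.SignedTransportAtTwo.signedTransportAtTwo_of_gvBinders` /
`…_of_gvBinders_matsunoShift` (ThetaPartnerAtTwoSignedTransportAtTwoBridgeGV.lean, 0 sorry) conclude
SignedTransportAtTwo BY NAME from three Greenberg–Vatsal-shape p = 2 binders: Kμ2′ `hmuT` (torsion
AND μ = 0 of X⁺(E) transported from the partner along E[2] ≅ A[2] — torsion is an OUTPUT, GV Thm
(1.4) shape; absorbs stub_torsion2), Kλ2 `hlam2` (B.D. Kim Cor 2.13 λ-half at 2 over an admissible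
odd S₀), V2′ `hV2` (μ-vanishing of the Néron-normalised signed 2-adic L-function transfers partner →
curve and the imprimitive λ-invariants agree, EPW Thm 1 shape at 2; LOAD-BEARING, no refereed source
at any p); FINDING of record (tp2-p1 g1 09:11:46Z, numbers): the λ-side local terms at 2 must be
Matsuno's s_ℓ·d̄_ℓ with s_ℓ = 2^{v₂((ℓ²−1)/8)} (tree
`Literature.NumberTheory.EllipticCurves.matsunoSigmaShiftAtTwo`, Matsuno2008 Cor 2.3 / Lemma 2.4 /
p. 418) — the tree's odd-p `GreenbergVatsal2000.delta W 2 v` (s-factor 2^{v₂(ℓ−1)−1}) mispredicts 6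
census pairs (e.g. 157113h1 ~ 27a1: predicted (7,2), observed (5,0) = KuriharaOtsuki2006 Rem 0.2(3)
in print) while the Matsuno shift reproduces all of them, so the SKELETON OF RECORD since
2026-08-27T09:29Z is line `bridge` v3 3b40a10fe1b905a6 (registered by the lead with `ledger skeleton
check … --crux stmt-BirchSwinnertonDyer-20333`; gate: rc 0, sorries 3 = stubs): stub_muTorsion2
(Kμ2′), stub_lam2m (Kλ2 with the Matsuno shift), stub_V2m (V2′, LOAD-BEARING), composition
`Theorems.SignedTransportAtTwo.signedTransportAtTwo_of_gvBinders_matsunoShift` (p517727); v1's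
stub_lam2/stub_V2 are MIS-TYPED AT 2 (δ) and stub_torsion2 is absorbed into Kμ2′ — superseded, not
dead lines. Line `birth` v3 (stub_finiteTorsionTwo, stub_invariantsTransportTwo) stays registered
and stub_unitOfInvariantsTwo / stub_nonvanishingTwo are LANDED (p509603, p508602);
stub_invariantsTransportTwo USES Σ_+ = ∅ (habitat ⇒ ℚ(√Δ_E) = K imaginary ⇒ Δ_E, Δ_A < 0 ⇒ H¹(ℝ,
E[2^k]) = 0: no archimedean local condition, Matsuno2008 §4 case Σ_+ = ∅) — the lemma «habitat ⇒ Δ <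
0» is a --supports helper for the prover, not an item. The habitat predicate in CLOSED FORM (CFT:
for h(−d) = 1, 2 inert, the ray class group of ℚ(√−d) mod (2) is 𝔽₄^×/⟨−1⟩ ≅ C₃, so M_d is the
UNIQUE S₃-field ⊃ ℚ(√−d) of cubic conductor (2); E lies on the habitat iff ℚ(√Δ_min) = ℚ(√−d) and
ℚ(E[2])/ℚ(√−d) is unramified at every odd prime) is a candidate support lemma, filed only if a
prover wants the ∃A clause eliminated; the existence census of CM partners that was listed here at
rev 0 is DONE (HABITAT-CENSUS-TP2-v1.md). UPDATE rev 15: SKELETON OF RECORD on 20333 since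
2026-08-27T10:05Z (tp2-p1 g1 FINAL) is line `bridge` v4 1d502501ca735f7e — stub_muTorsion2 (Kμ2′,
unchanged), stub_lam2d (Kλ2 at 2 with local weights 2^{n_ℓ}·d_ℓ, n_ℓ = ord₂((ℓ²−1)/8) = the number
of primes of ℚ_∞ above ℓ at p = 2, Matsuno2008 pp. 415/418; tree
`TwoAdicTwistConverse.valuation_frobeniusExponent_two_eq`), stub_V2np (LOAD-BEARING: congruence of
the NON-PRIMITIVE — Euler-factor-stripped over an admissible S₀ — Néron-normalised signed 2-adic
L-functions of W and A: equal λ and μ = m vs m′, GV §1/§3 · Vatsal1999 · EPW Thm 1 SHAPE read at 2;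
no local correction terms appear), composition LANDED p520200
`Theorems.SignedTransportAtTwo.signedTransportAtTwo_of_gvBinders_nonPrimitive`
(ThetaPartnerAtTwoSignedTransportAtTwoBridgeNonPrimitive.lean, 0 sorry; §3 kernel witnesses
`sFactor_two_five_ne` / `sFactor_two_seven_ne` that the odd-p `GreenbergVatsal2000.sFactor/delta`
read at 2 is NOT the p = 2 weight); v3's stub_lam2m / stub_V2m are superseded (card
HOME/bsd-wall-p2/lines/SignedTransportAtTwo_bridge_v4.md). A ready-made glued split of
SignedTransportAtTwo into its three v4 binders (`--glue-by` p520200) is on offer post-freeze if more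
K1 seats are wanted; not filed (each child would be an unvetted crux). On 20312 (#3): line
`rankzero` (tp2-p2 g1, 5506ab743281865b): stub_torsionCMTwo · stub_kimControlCMTwo ·
stub_lowerDivisibilityCMTwo (LOAD-BEARING, `KobayashiLowerDivisibility A 2 1` for rank-0 CM A) ·
stub_analyticMuFlatCMTwo · stub_generatorChangeCMTwo (provable infrastructure) ·
stub_publishedInputsCMTwo (cite-only), composition = p519461. CROSS-ROUTE (memo
HOME/bsd-wall-p2/xroute/CROSS-ROUTE-TP2-K3K4-v1.md): #5's finite-generation conjunct is the tree
theorem `Kobayashi2003.SignedSelmerDualData.moduleFinite` (kernel sketch xroute/SketchK4i.lean) and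
#4 is the rational part of ByReductionTypeAtTwo 19097 stub (4) `stub_zeroColemanKato` via
`exists_pow_mul_mem_charIdeal_of_colemanSkeletonRat` — shared `--supports` helpers H3/H4, no shared
items (T7).
CHEAPEST FALSIFIER. Showcase pair E = 19a1 = [0,1,1,−9,−15] (non-CM, r = 0, good ss at 2, a₂ = 0,
Δ_min = −19³, multiplicative at 19) and A = 361a1 = [0,0,1,−38,90] (CM by ℤ[(1+√−19)/2], 2 inert, a₂
= 0). E[2] ≅ A[2] is now CERTIFIED EXACTLY (not sampled): with ψ = X³ + b₂X² + 8b₄X + 16b₆,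
Res_Y(ψ_E(Y), ψ_A(x−Y)) = (x³ + 4x² − 144x + 576)·(x⁶ + 8x⁵ − 2096x⁴ + 3040x³ + 1165952x² −
12325888x + 34939136) in ℤ[x], squarefree ⇒ ℚ(E[2]) = ℚ(A[2]) = M₁₉ (S₃) ⇒ isomorphic Galois modules
(HABITAT-CENSUS-TP2-v1.md §1–2). KIT-FREE part of the kill, RUN (v1): the transport law λ^±(E) +
Σ_{Σ₀}δ_ℓ(E) = λ^±(A) + Σ_{Σ₀}δ_ℓ(A) (Σ₀ = odd bad primes of E·A; at p = 2: δ_ℓ = 0 additive, s_ℓ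
multiplicative, 2s_ℓ good with a_ℓ even, 0 good with a_ℓ odd, s_ℓ = 2^{v₂((ℓ²−1)/8)}) holds on all
three habitat pairs with both sides in the ENGINE-2 table (110693a1 ~ 121b1, 393129bx1 ~ 121b1,
157113h1 ~ 27a1: 6/6) and, at rev 5, on ALL 223 Δ < 0 packet pairs of the block (446/446 sign-tests,
PACKETS-X5SS-v1) while failing on 31/32 Δ > 0 pairs that violate Matsuno's Σ_+ condition — it COULD
have failed on the habitat side and did not. That kit job is now RUN (j273215, 08:22Z): 361a1 reads
(4, 1, 0, 0) and 3249a1 reads (6, 3, 0, 0) exactly as predicted, and so does every other predicted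
row (24/24; μ = 0 on 25/25) — the analytic transport law COULD have failed across the non-CM ↔ CM
congruence at 2 and did not, on all 19 habitat classes. The cheapest REMAINING falsifiers: (a) a
second-engine reading of the 16 single-engine rows (the 9 rows inside ENGINE-1's SF2-ALL table —
incl. 361a1, 3249a1, 1849a1 — already agree two-engine, see the memo's addendum), (b) the M₆₇ class
(anchor 4489a1 now read (2, 1); no habitat curve of that class is in the X5 window), (c) the
algebraic side, reachable only by a disproof seat on 20333/20308/20309 (a habitat curve whose
2-descent data contradict the Kim control value g(0) ~ 2^{v₂ ∏c}·#Ш[2^∞] predicted from λ♭, μ = 0).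
For the record, the job that was asked: L₂^± of 361a1 (Euler factor at 19 enters only through Σ₀ =
{19}: δ₁₉(19a1) = 1, δ₁₉(361a1) = 0) against the prediction (λ♯, λ♭, μ♯, μ♭) = (4, 1, 0, 0), and —
the partner `closes` actually uses since rev 7 (A of analytic rank 0; 361a1 itself has rank 1,
L(361a1,1) = 0, so its own Pollack pair is not tree-exhibitable) — its rank-0 twist 3249a1 =
361a1^(−3) against (6, 3, 0, 0) (Σ₀ = {3, 19}); any other value kills SignedTransportAtTwo (λ) or
SignedMainConjectureCMTwo (μ); a uniform offset on ALL anchor rows would instead indicate a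
normalisation convention (packet KIT-INPUT-TP2-CM-ANCHORS-v1 decision rule).

NUMBERS. Block of record (cell bsd-2adic, x5_by_type_at_2.json sha16 64dd3f21c3c2cf48; X5 residue
classes N < 5·10⁵, good supersingular at 2): 763 classes = 757 rank 0 + 6 rank 1; rank-0 split a₂ =
0 : +2 : −2 = 208 : 483 : 66; E[2] irreducible with S₃ image on 208/208 of the a₂ = 0 classes. THETA
HABITAT (exact census HABITAT-CENSUS-TP2-v1.md sha16 7fe48c52e6a49e6b; rank-0 partners
HABITAT-CENSUS-TP2-v1.1 8f55ee00fd12ff8f: every one of the 19 classes has a CM partner of analytic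
rank 0 — a D ≡ 1 (mod 4) quadratic twist of its anchor, 15 certified in Cremona's allbsd tables, 4
by local L-series values L(A^D,1) ∈ {1.2456, 2.7742, 3.2830, 3.5092} ≠ 0): 19 of 208 (9.1 %) — d =
3: 12 (partners y² + y = x³ + c, c ∈ {30 (×3), 4290 (×2), 0 [class 27a], 1, 8, 10, 90, 4032, −15}),
d = 11: 2 (110693a1, 393129bx1 ~ 121b1), d = 19: 2 (282093g1, 455221c1 ~ 361a1), d = 43: 2 (35131b1,
434429c1 ~ 1849a1), d = 163: 1 (132845b1 ~ 26569a1), d = 67: 0; smallest habitat class 14157s1 (N =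
3²·11²·13), smallest with d ≠ 3: 35131b1 (N = 19·43²); OFF-habitat 189 = 187 (ℚ(√Δ_min) not a CM
field with 2 inert) + 2 (right quadratic field, different 2-division field: 166419q1 d = 11,
363609l1 d = 67 — an additive potentially-good odd prime with inertia of order divisible by 3 on
E[2]). Share: ≤ 0.40 % of the 4 730 row-1 r0 residue cells of CENSUS-EXCLUSIONS v1.1, 0/20 r1.
Control outside X5: 19a1 ~ 361a1 (Ш_an = 1). CM fields with 2 inert and a CM curve over ℚ: ℚ(√−3),
ℚ(√−11), ℚ(√−19), ℚ(√−43), ℚ(√−67), ℚ(√−163) (h = 1, −d ≡ 5 mod 8). Transport-law evidence: 3 read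
pairs 6/6, 6 packets 15 curves 0 conflicts; predictions for 12 unread CM anchors tabulated (§6 of
the census). PACKETS (PACKETS-X5SS-v1.md ba22f7da916d4685; 770 curves = 763 X5 + 6 CM anchors +
19a1; 152 exact certificates, 0 undecided): 84 packets / 236 members (61 packets Δ < 0 with 175
curves, 23 packets Δ > 0 with 61); 291 read pairs: Δ < 0 223 pairs 446/446 sign-tests obey the law
(121 same-a₂, 102 mixed-a₂); Δ > 0 with σ(min) = min 36 pairs 72/72; Δ > 0 with σ(min) ≠ min 32
pairs: 24 fail on both signs, 7 on one, 1 accidental agreement; residuals even, ♯ ∈ {−4, −2, 2, 4,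
8, 14}, ♭ ∈ {−10, −4, −2, 2, 4}.

DEFINITION REQUESTS. None now: every item is typed over existing declarations
(Kobayashi2003.SignedSelmerDualData, Supersingular.KobayashiMainConjecture /
IsPollackPair / kobayashiL at p = 2, WeierstrassCurve.geomTorsion). Wanted later (skeleton level):
element-level μ/λ of Λ = ℤ₂⟦T⟧
(today spelled through muInvariant of Λ/(g)).

Novelty: Searches (2026-08-27): lit search "Burungale Flach Birch Swinnerton-Dyer complex multiplication"
(local: 8 docs; held arXiv:2206.09874 read
pp. 3, 6, 17–18); lit search "Pollack Rubin main conjecture CM elliptic curves supersingular" (6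
docs citing PR04; PR04 itself not held);
lit galaxy search "CM elliptic curves at supersingular primes" --star all (1 hit:
panama:391752557002789 Kriz 2021, unrelated); earlier this
session: lit search/vsearch on "Iwasawa main conjecture p = 2 imaginary quadratic" (held:
arXiv:1311.3565 Oukhaba–Viguié μ = 0 split line,
arXiv:2002.05647 Müller split-prime MC at 2, arXiv:1103.1125 Viguié), lean search geomTorsion /
BDKim2009 (tree: cor213_signedMu…, cor213_signedLambda…
with guard p ≠ 2), the 2adic cell's card index (idea-dihedral-rigidity-two v2) and routes
ByReductionTypeAtTwo rev 19 / TwoAdicConverse rev 16.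
Nearest prior art found: BDKim2009 Cor 2.13 (signed λ/μ transport, p odd; tree facts with `p ≠ 2`);
Matsuno2008 Thm 4.2 (ordinary transport AT 2,
tree fact `matsuno2008_thm42_transport_two_irreducible`); PollackRubin2004 (± MC for CM curves, p
odd); BurungaleFlach2024 (K-main conjecture used at every p);
in the tree: the ORDINARY odd-p CM-partner transfer is already typed —
`Literature.NumberTheory.EllipticCurves.GreenbergVatsal2000.mazurMainConjecture_of_cmCongruence` /
`thm14Hypothesis_of_cm` (GV Thm 1.4 + Rubin1991 Thm 12.3, p ≠ 2 good ordinary, p split in K) used by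
`Theorems/SmallImageMuTransferMuTransferX9CMPartnered.lean` (route Sm  [refs: 2206.09874, 1311.3565, 2002.05647, 1103.1125, paper:arxiv-2508.09733, BDKim2009, Matsuno2008, PollackRubin2004, BurungaleFlach2024, GreenbergVatsal2000, Rubin1991, CorpuzLei2025, HatleyLei2019]

Barriers (technique_class: congruence-transport, cm-elliptic-units, kato, signed-selmer): - technique_class: congruence-transport, cm-elliptic-units, kato, signed-selmer
- Literature.Barriers.BirchSwinnertonDyer.SignedIwasawaTheoryAtTwoBarrier: it does not evade it —
this is the literature GAP the route fills (every algebraic signed fact is printed for p odd); the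
bet is that on the habitat the usual p = 2 nuisances are absent: E(ℚ_2,n)[2] = 0 along the
cyclotomic tower (ρ̄|D₂ irreducible with a 3-cycle survives 2-power extensions), (O_K/2)^× = 𝔽₄^×
has odd order 3 (semisimple Δ-decomposition on the CM side), and Sprung/Pollack pairs exist at 2
(tree theorem `exists_isPollackPair_two`).
- Literature.Barriers.BirchSwinnertonDyer.EulerSystemBigImageBarrier: (a) its locus «E[p]
irreducible ∧ ρ̄_{E,p} not surjective» is EMPTY on the habitat, by tree theorems: W good
supersingular at 2 ⇒ W[2] irreducible (`P2.irr_two_of_goodSS_two`) and Δ_W ≡ 5 mod 8 is not a square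
(`P2.not_isSquare_Δ_of_goodSS_two`), and an irreducible subgroup of GL₂(𝔽₂) ≅ S₃ not inside A₃ is
everything — ρ̄_{W,2} is onto GL₂(𝔽₂) for EVERY class of the habitat (`P2.surj_two_of_goodSS_two`,
granted the DD2012 criterion fact; locally already ρ̄(D₂) = normaliser of the non-split Cartan,
Serre 1972 §1.11); (b) independently, no crux instantiates an INTEGRAL big-image divisibility of the
class: K3 is typed up to a power of 2 (∃ m, g·h = 2^m ϖ L⁺: Kato 13.4 (2)/12.5 (3)-shape rational
divisibility through the + Coleman map, no (12.5.2)/σ-hypothesis — printed under p ≠ 2 anyway), the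
2-power being recovere

History (route lifecycle, newest last):
- 2026-08-27T07:59:14Z · rev 7: restated SignedTransportAtTwo (stmt-BirchSwinnertonDyer-20306), OffThetaHabitatAtTwo (stmt-BirchSwinnertonDyer-20310) — rev 7: repair K1 per tp2-p1 audit 07:33Z — SignedTransportAtTwo restated 1:1 (same name) FRAMED by A's analytic data (f_A, ϖ_A, Pollack pair at 2); residual Off (planner-bsd-wall-p2-g3-0)
- 2026-08-27T09:35:05Z · closes_target -> closes rung W-ALL/1.hab of BirchSwinnertonDyer: Summit.BirchSwinnertonDyer.WAllNonCMAtTwoThetaHabitat (D-0061; not the summit Statement) (planner-bsd-wall-p2-g4-0)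
- 2026-08-27T10:26:32Z · AUTO-CRUX (edit): SignedMainConjectureCMTwoRankZero — hypotheses of the deciding theorem that nothing in the route derives are cruxes (planner-bsd-wall-p2-g5-0)

sub-problem: BirchSwinnertonDyer · status: open · opened planner-bsd-wall-p2-g0-0 2026-08-27T05:40:36Z · rev 47 · ledger route-BirchSwinnertonDyer-ThetaPartnerAtTwo
GENERATED by the gate from the ledger (D-0016/17). Provers cite these decls: `theorem foo : Summit.BirchSwinnertonDyer.BirchSwinnertonDyer.Theses.ThetaPartnerAtTwo.<Decl> := …` in Summits/BirchSwinnertonDyer/BirchSwinnertonDyer/Theorems/<Name>.lean.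
-/

namespace Summit.BirchSwinnertonDyer.BirchSwinnertonDyer.Theses.ThetaPartnerAtTwo

open scoped BigOperators Topology Manifold Classical MeasureTheory ProbabilityTheory Matrix InnerProductSpace ComplexConjugate ContinuousMap
open Filter Set Function TopologicalSpace MeasureTheory

attribute [summit_statement] _root_.BirchSwinnertonDyer
attribute [summit_statement] _root_.Summit.BirchSwinnertonDyer.WAllNonCMAtTwoThetaHabitat

open Literature

/-- item stmt-BirchSwinnertonDyer-25631 · crux · rank 4 · SPLIT (gen 1) into KatoEulerSystemTatePairingValuesTwoInput, SignedKatoDivisibilityUpToAtTwoOfPubOfKatoFact + glue SignedKatoDivisibilityUpToAtTwoOfPubGlue · direct attempts still welcome (low priority) · by planner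
why it might fail: R2c at p = 2 is unprinted: needs the T₂E-adic layer-n local Tate pairings as MAPS with (P1) corestriction/(P2)/(P3), Poitou–Tate orthogonality along ℚ_∞ and the explicit reciprocity law at 2 (Col(z_Kato) ~ L♭; Otsuki 2009 is printed for odd p) — a 2-power defect in ERL@2 breaks `up to 2^m`.
sources: Kobayashi2003, Sprung2012, Kato2004Asterisque, KuriharaOtsuki2006, Otsuki2009
[crux — twin K3P′, the PHASE-T pattern (K2r0P/K4P/KλP): K3 FROM ITS PUBLISHED INPUTS, print-exact]
Kato 2004 Thm 13.4(2) at p = 2 in its PRINT-EXACT contragredient form (fact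
`Kato2004.thm13_4_two_lengthAt_fineSelmerDualContra_le_of_isEulerSystemClassTwo`, p599770, typer
g18; Y : FineSelmerDualData κ γ⁻¹ against I : IwasawaH1Data W 2 κ γ — the K3 lead's convention audit
G4 §1 and the second reader agree this is print) → GZK (fact
`rank_eq_analyticRank_of_analyticRank_le_one`) → ⟨item 20308 `SignedKatoDivisibilityUpToAtTwo` body
VERBATIM⟩ (1494 chars). Research content = EXACTLY the K3 lead's registered research stub: R2c
`stub_layerSideTwoInv` of line colemanrat v7 (4099f1720feba091; G4-LEAD-v7.md: a (D-layer)
DEFINITION «T₂E-adic local Tate pairing at layer n with (P1)(P2)(P3)» + an L-sized Poitou–Tate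
assembly + the PUB pair Kato 12.5 / Otsuki-2009-at-2) with kernel certificate
`SignedKatoOffTwo.signedKatoDivisibilityUpToAtTwo_of_contraFact_of_gzk_of_layerSide : K2′-fact → GZK
→ R2c → K3` LANDED (p603443; earlier variants R2^ι p600818, R2b p602460), so K3P′ ⟸ R2c by `fun hR2c
hK hG => … hK hG hR2c` (pen cert RouteCtxK3C3tp2.lean pathnode examples); in-tree FE
`signedKatoDivisibil -/
@[route_item "route-BirchSwinnertonDyer-ThetaPartnerAtTwo", crux]
def SignedKatoDivisibilityUpToAtTwoOfPub : Prop :=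
  Literature.NumberTheory.EllipticCurves.Kato2004.thm13_4_two_lengthAt_fineSelmerDualContra_le_of_isEulerSystemClassTwo → Literature.NumberTheory.EllipticCurves.rank_eq_analyticRank_of_analyticRank_le_one → ∀ (W : WeierstrassCurve ℚ) [W.IsElliptic] [W.IsGloballyMinimal], ¬ W.HasCM → W.analyticRank = 0 → Literature.NumberTheory.EllipticCurves.Rank1Residual.GoodSS W 2 → W.frobeniusTrace 2 = 0 → ∀ (κ : Literature.NumberTheory.EllipticCurves.ZpExtension ℚ 2) (γ : Field.absoluteGaloisGroup ℚ), κ.IsCyclotomic → κ.IsTopGenerator γ → Literature.NumberTheory.EllipticCurves.IsCyclotomicVariable 2 γ → ∀ [NeZero (W.conductorNorm ℤ)] (f : CuspForm (CongruenceSubgroup.Gamma0 (W.conductorNorm ℤ)) 2), Literature.NumberTheory.EllipticCurves.ModularForms.IsNewformOf W f → ∀ (ϖ : ℚ), (ϖ : ℝ) * W.realPeriodRat = Literature.NumberTheory.EllipticCurves.ModularForms.plusPeriod f → ∀ (Lplus Lminus : Literature.NumberTheory.EllipticCurves.IwasawaAlgebra 2), Summit.BirchSwinnertonDyer.Rank1Residual.Supersingular.IsPollackPair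 f 2 Lplus Lminus → ∀ (D : Literature.NumberTheory.EllipticCurves.Kobayashi2003.SignedSelmerDualData W κ γ 1), ∃ (g h : Literature.NumberTheory.EllipticCurves.IwasawaAlgebra 2) (m : ℕ), D.charIdeal = Ideal.span {g} ∧ Literature.NumberTheory.EllipticCurves.iwasawaToPowerSeries 2 (g * h) = PowerSeries.C ((2 : ℚ_[2]) ^ m * (ϖ : ℚ_[2])) * Literature.NumberTheory.EllipticCurves.iwasawaToPowerSeries 2 (Summit.BirchSwinnertonDyer.Rank1Residual.Supersingular.kobayashiL 1 Lplus Lminus)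

-- parent: SignedKatoDivisibilityUpToAtTwoOfPub · child (gen 1)
/--     item stmt-BirchSwinnertonDyer-22680 · support · rank 401 · open
    parent: SignedKatoDivisibilityUpToAtTwoOfPub · by planner
    sources: Kato2004Asterisque, Rubin1998Durham, Kobayashi2003, BlochKato1990
[support, HOLD — published input BY NAME, no restatement: the Literature fact F
`Kato2004.exists_eulerSystem_expStar_tatePairing_values_two` (p640688; Kato 2004 Astérisque 295 Thm.
12.5 (1) pp. 221–222 with (8.1.3), Prop. 8.12, Thm. 9.7, Thm. 6.6 (1), Ex. 13.3; Rubin 1998 §5/Thm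
7.1; Kobayashi 2003 Thm 5.2 (i), (8.23); Bloch–Kato 1990 Prop. 3.8) = the registered print stub
stub_katoTatePairingFactTwo of K3P′'s line colemanrat v16 (K3 LEAD tp2-p2x g9 audit
G9-LEAD-AUDIT.md: inputs print-exact, no residue). Closing = the fact's `_holds` landing
(typer/inputs desk), never a prover target. USE: child C turns it into K3P′ 25631 by p642700.]
Kato's Euler system for V = V_2(E) with the dual-exponential / Tate-pairing value law at p = 2
(standard frame). [deps: SignedKatoDivisibilityUpToAtTwoOfPub] [difficulty: print] -/
@[route_item "route-BirchSwinnertonDyer-ThetaPartnerAtTwo"]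
def KatoEulerSystemTatePairingValuesTwoInput : Prop :=
  Literature.NumberTheory.EllipticCurves.Kato2004.exists_eulerSystem_expStar_tatePairing_values_two

-- parent: SignedKatoDivisibilityUpToAtTwoOfPub · child (gen 1)
/--     item stmt-BirchSwinnertonDyer-22681 · support · rank 402 · closed · proved by Summit.BirchSwinnertonDyer.BirchSwinnertonDyer.Theorems.signedKatoDivisibilityUpToAtTwoOfPubOfKatoFact_proof (prover)
    parent: SignedKatoDivisibilityUpToAtTwoOfPub · by planner
    sources: Kato2004Asterisque, Kobayashi2003
[support, certificate — closable BY NAME in one line by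
`Summit.BirchSwinnertonDyer.BirchSwinnertonDyer.Theorems.SignedKatoOffTwo.KatoBK.signedKatoDivisibilityUpToAtTwoOfPub_of_kato_tatePairing_fact`
(p642700, tp2-p2x widths; RTT twin p643575); pen cert K3ctxTP2.lean `ofKatoFact_closer` rc 0] the
published input H gives K3P′: F → SignedKatoDivisibilityUpToAtTwoOfPub (the whole kernel chain
coreKZ_of_coreKZLit → corePairChiPrim_of_coreKZ_of_bricks →
CoreChi.signedKatoDivisibilityUpToAtTwoOfPub_of_corePairChiPrim with the four unconditional bricks).
[deps: KatoEulerSystemTatePairingValuesTwoInput, SignedKatoDivisibilityUpToAtTwoOfPub] [difficulty: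
XS] -/
@[route_item "route-BirchSwinnertonDyer-ThetaPartnerAtTwo"]
def SignedKatoDivisibilityUpToAtTwoOfPubOfKatoFact : Prop :=
  KatoEulerSystemTatePairingValuesTwoInput → SignedKatoDivisibilityUpToAtTwoOfPub

-- `SignedKatoDivisibilityUpToAtTwoOfPubOfKatoFact` holds: proved by `Summit.BirchSwinnertonDyer.BirchSwinnertonDyer.Theorems.signedKatoDivisibilityUpToAtTwoOfPubOfKatoFact_proof` (its module imports this route file, so no `_holds` link can be stated here).

-- parent: SignedKatoDivisibilityUpToAtTwoOfPub · glue (gen 1)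
/--     item stmt-BirchSwinnertonDyer-22682 · support · rank 403 · closed · proved by Summit.BirchSwinnertonDyer.BirchSwinnertonDyer.Theorems.signedKatoDivisibilityUpToAtTwoOfPubGlue_proof (prover)
    parent: SignedKatoDivisibilityUpToAtTwoOfPub · GLUE: children ⟹ parent · by planner
the published Kato input H (HOLD) and the one-hypothesis certificate K3P-of-H give K3P: fun hH hC =>
hC hH -/
@[route_item "route-BirchSwinnertonDyer-ThetaPartnerAtTwo"]
def SignedKatoDivisibilityUpToAtTwoOfPubGlue : Prop :=
  KatoEulerSystemTatePairingValuesTwoInput → SignedKatoDivisibilityUpToAtTwoOfPubOfKatoFact → SignedKatoDivisibilityUpToAtTwoOfPub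

-- `SignedKatoDivisibilityUpToAtTwoOfPubGlue` holds: proved by `Summit.BirchSwinnertonDyer.BirchSwinnertonDyer.Theorems.signedKatoDivisibilityUpToAtTwoOfPubGlue_proof` (its module imports this route file, so no `_holds` link can be stated here).

/-- item stmt-BirchSwinnertonDyer-26470 · crux · rank 5 · closed · proved by Summit.BirchSwinnertonDyer.BirchSwinnertonDyer.Theorems.AnalyticMuFlatCMTwoRankZero_proof (prover) · by planner
why it might fail: Instance of Perrin-Riou's μ^±=0 conjecture at p=2 (Pollack2003 Conj 6.3; Pollack–Weston 2011 Rem 4.2: open incl. CM): a rank-0 CM member on the j=0 tail (ρ̄=Ind χ_m, no member of conductor <5·10⁵) with μ(L♭)>0 kills it; certified only for 762/762 classes <5·10⁵.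
sources: Pollack2003, PerrinRiou2003, arXiv:0906.1741, arXiv:2409.18021, arXiv:2504.05734, Kobayashi2003
[crux — FLAT = (μ♭)_A, the conjecture-grade μ-INPUT of the K2 column; text = registered stub
stub_analyticMuFlatNonUnitCMTwo of line rankzero v14 VERBATIM under an `open … in` prefix (lead
tp2-p2 g7/g8 FREEZE 06:49:03Z, K2r0PFlatCert v2 29fd7b4db6c99cf7; pen cert K2FctxTP2v3f.lean
`flat_iff_frozen := Iff.rfl`, rc 0)] For every CM curve A/ℚ of analytic rank 0, good supersingular
at 2 with a₂(A) = 0, OFF the unit zone (2 ∣ #Ш(A)·∏c_ℓ), every newform f of A and every Pollack pair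
(L⁺, L⁻) of f at 2: Kobayashi's L♭ = kobayashiL 1 L⁺ L⁻ has a unit coefficient (μ(L♭) = 0). This is
Perrin-Riou's μ^± = 0 conjecture at p = 2 on these classes: OPEN-PROBLEM grade class-wide
(Pollack–Weston 2011 Rem 4.2; arXiv:2409.18021 Rem 1.2; arXiv:2504.05734), CERTIFICATE-grade per
residual class via (G′)_N / SignedMuAtTwo.flatAtTwo_of_cuspSpan (tp2-p2-w3 FLAT-CENSUS: 762/762 CM
classes of odd conductor < 5·10⁵; open tail ρ̄ = Ind_{ℚ(√−3)} χ_m, j = 0). Binder hFlat of closes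
v3f; the route stays conditional on it per residual class (lead R4 06:09:28Z); candidate `residual`
for the tribunal. BSD is not proved by filing this. -/
@[route_item "route-BirchSwinnertonDyer-ThetaPartnerAtTwo", crux]
def AnalyticMuFlatCMTwoRankZero : Prop :=
  open CongruenceSubgroup Literature.NumberTheory.EllipticCurves Literature.NumberTheory.EllipticCurves.ModularForms Literature.NumberTheory.EllipticCurves.Rank1Residual Summit.BirchSwinnertonDyer.Rank1Residual.Supersingular in ∀ (A : WeierstrassCurve ℚ) [A.IsElliptic] [A.IsGloballyMinimal], A.HasCM → A.analyticRank = 0 → GoodSS A 2 → A.frobeniusTrace 2 = 0 → 2 ∣ A.shaOrder * A.tamagawaProduct → ∀ [NeZero (A.conductorNorm ℤ)] (f : CuspForm (Gamma0 (A.conductorNorm ℤ)) 2), IsNewformOf A f → ∀ (Lplus Lminus : IwasawaAlgebra 2), IsPollackPair f 2 Lplus Lminus → ∃ n : ℕ, IsUnit (PowerSeries.coeff n (kobayashiL 1 Lplus Lminus))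

-- `AnalyticMuFlatCMTwoRankZero` holds: proved by `Summit.BirchSwinnertonDyer.BirchSwinnertonDyer.Theorems.AnalyticMuFlatCMTwoRankZero_proof` (its module imports this route file, so no `_holds` link can be stated here).

/-- item stmt-BirchSwinnertonDyer-26471 · crux · rank 3 · SPLIT (gen 1) into KatoZetaErlKSideCMAtTwoSupply, SignedMainConjectureCMTwoRankZeroOfPubOfFlatOfKZ + glue SignedMainConjectureCMTwoRankZeroOfPubOfFlatGlue · direct attempts still welcome (low priority) · by planner
why it might fail: PollackRubin2004 Thm 7.3 is printed for p>2; at inert 2 the port runs via Kato2004 Prop 15.9+(15.6.4), JLK2011 Thm 5.2, BurungaleFlach2024 Prop 3.1 — a 2-power in the elliptic-unit index / period ratio ϖ_A off the unit zone (char X⁺=(2^k·L♭), k≠0) on some rank-0 CM class kills it.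
sources: PollackRubin2004, Kato2004Asterisque, JohnsonLeungKings2011, BurungaleFlach2024, Rubin1991, arXiv:2206.09874
[crux — K2R0P♭, the μ-FREE twin of K2r0P 24945 and the PROMOTE / PORT target of the K2 column
(director-bsd W-78 (c)(d); lead tp2-p2 g8 FREEZE 06:49:03Z)] PUB¹⁰ (24945's ten published-input
antecedents VERBATIM) → FLAT `AnalyticMuFlatCMTwoRankZero` (by name) → ⟨24945's body VERBATIM⟩ (pen
cert K2FctxTP2v3f.lean: `k2f_iff_frozen := Iff.rfl` vs K2r0PFlatCert v2; lossless
`k2r0p_of_flat_of_k2f : FLAT → K2R0P♭ → 24945` and `k2f_of_k2r0p : 24945 → K2R0P♭`, both fun-terms;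
rc 0). Content: for every CM curve A/ℚ of analytic rank 0, good supersingular at 2, a₂ = 0:
X⁺(A/ℚ_∞) Λ-torsion with μ⁺ = 0 for every cyclotomic datum, and Kobayashi's + main conjecture at 2 —
GIVEN μ(L♭) = 0: Pollack–Rubin 2004 Thm 7.3 at the inert prime 2 minus its μ-part = PORT-OF-PRINT
grade (Kato 2004 Astérisque 295 Prop 15.9 + (15.6.4) + (15.12.2) + (15.16.1), Lemma 15.13 off (2);
Johnson-Leung–Kings 2011 Thm 5.2; Burungale–Flach 2024 Prop 3.1 — ER2-PRINT-SOURCE-w2.md v1.1);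
kernel doors landed: D_MC ⟹ this (`Cert.ofPubOfFlat_of_upToTwoPower`, p609811/p610219 length
currency, (MC-len)_A ⟹ this `ofPubOfFlat_of_length`); the lead registers its one-stub skeleton
((MC-len)_A / D_MC) on this id. Binder hCMPf of closes -/
@[route_item "route-BirchSwinnertonDyer-ThetaPartnerAtTwo", crux]
def SignedMainConjectureCMTwoRankZeroOfPubOfFlat : Prop :=
  Literature.NumberTheory.EllipticCurves.bsdTriple_of_hasCM_of_L_one_ne_zero → Literature.NumberTheory.EllipticCurves.ModularForms.nonempty_modularParametrizationData → WeierstrassCurve.hasEntireLFunction_rat → Literature.NumberTheory.EllipticCurves.rank_eq_analyticRank_of_analyticRank_le_one → Literature.NumberTheory.EllipticCurves.realPeriodRat_eq_unit_mul_plusPeriod_two → Literature.NumberTheory.EllipticCurves.Greenberg1999.casselsSurjectivity_H1Sigma ℚ → Literature.NumberTheory.EllipticCurves.Greenberg1999.prop412_noFiniteSubmodule_H1Sigma_of_rank_one → Literature.NumberTheory.EllipticCurves.Greenberg1999.h1Sigma_zpCorank_le_degree ℚ → Literature.NumberTheory.EllipticCurves.Greenberg1999.localQuotient_restriction_surjective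 ℚ → Literature.NumberTheory.EllipticCurves.Greenberg1999.h1SigmaInfty_rank_eq_one → AnalyticMuFlatCMTwoRankZero → ∀ (A : WeierstrassCurve ℚ) [A.IsElliptic] [A.IsGloballyMinimal], A.HasCM → A.analyticRank = 0 → Literature.NumberTheory.EllipticCurves.Rank1Residual.GoodSS A 2 → A.frobeniusTrace 2 = 0 → (∀ (κ : Literature.NumberTheory.EllipticCurves.ZpExtension ℚ 2) (γ : Field.absoluteGaloisGroup ℚ), κ.IsCyclotomic → κ.IsTopGenerator γ → ∀ D : Literature.NumberTheory.EllipticCurves.Kobayashi2003.SignedSelmerDualData A κ γ 1, Module.IsTorsion (Literature.NumberTheory.EllipticCurves.IwasawaAlgebra 2) D.X ∧ D.mu = 0) ∧ Summit.BirchSwinnertonDyer.Rank1Residual.Supersingular.KobayashiMainConjecture A 2 1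

-- parent: SignedMainConjectureCMTwoRankZeroOfPubOfFlat · child (gen 1)
/--     item stmt-BirchSwinnertonDyer-28306 · support · rank 301 · open
    parent: SignedMainConjectureCMTwoRankZeroOfPubOfFlat · by planner
    sources: Kato2004Asterisque, Kobayashi2003, JohnsonLeungKings2011, Otsuki2009, PollackRubin2004, Rubin1991
[support — HOLD, PUB-shaped bundle KZ of PUBLISHED INPUTS on the CM/Kato side for the K2 column
(displayed, never a prover research target; text = crux workfile
Cruxes/SignedMainConjectureCMTwoRankZeroOfPubOfFlat/KZHold.lean a1d19d095207 `KZText` = registered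
stub `stub_zetaErlKSideCMTwo` of line rankzero v21 VERBATIM, one line, comments stripped; lead
tp2-p2 g10/g11 KZ-DESIGN-g11.md §4; pen cert KZctxTP2.lean rc 0)] Kato 2004 for the CM newform f_A
at p = 2, at every height-one prime 𝔭′ ∌ 2 of Λ: a Honda-type norm-compatible system of local points
at the place over 2 (Kobayashi 2003 (8.23) / Otsuki 2009 dictionary), Kato's zeta element s ∈
𝐇¹(T₂A) with the explicit reciprocity law (Thm 12.5 / (15.12.2)) ON THE T₂A-adic layer pairings
(P1)(P2)(P3) against the Mazur–Tate elements θ_n(f_A) with multipliers μ, ν ∉ 𝔭′, and ONE §15 K-side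
transport datum `KatoDescent.KSideDatum I Y s 𝔭′` (Lemma 15.13 off (2), §15.15, (15.16.1);
Johnson-Leung–Kings 2011 Thm 5.7 at the regular primes §7.2 — unconditional, no μ hypothesis there).
Every sentence is parity-free print at 𝔭′ ∌ 2 (KZ-DESIGN-g11 §3/§3b); the 2-power / μ content of the
K2 column lives in the declared residual FLAT 26470, not here -/
@[route_item "route-BirchSwinnertonDyer-ThetaPartnerAtTwo", crux]
def KatoZetaErlKSideCMAtTwoSupply : Prop :=
  open scoped Classical NumberField MatrixGroups ModularForm in open NumberField IsDedekindDomain CongruenceSubgroup WeierstrassCurve Literature Literature.NumberTheory.EllipticCurves Literature.NumberTheory.GaloisRepresentations Literature.NumberTheory.EllipticCurves.ModularForms Literature.NumberTheory.EllipticCurves.Rank1Residual Literature.NumberTheory.EllipticCurves.IwasawaDual Literature.NumberTheory.EllipticCurves.Kobayashi2003 Literature.NumberTheory.EllipticCurves.Module Literature.NumberTheory.EllipticCurves.Kato2004 Literature.NumberTheory.EllipticCurves.Kato2004.EulerSystemValues Literature.NumberTheory.EllipticCurves.GreenbergSelmer Literature.NumberTheory.EllipticCurves.Sprung2012 ZpExtension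 Summit.BirchSwinnertonDyer.Rank1Residual.Supersingular Summit.BirchSwinnertonDyer.BirchSwinnertonDyer.Theorems.SignedKatoOffTwo in ∀ (v : HeightOneSpectrum (𝓞 ℚ)), ((2 : ℕ) : 𝓞 ℚ) ∈ v.asIdeal → ∀ (A : WeierstrassCurve ℚ) [A.IsElliptic] [A.IsGloballyMinimal], A.HasCM → A.analyticRank = 0 → GoodSS A 2 → A.frobeniusTrace 2 = 0 → 2 ∣ A.shaOrder * A.tamagawaProduct → ∀ (κ : ZpExtension ℚ 2) (γ : Field.absoluteGaloisGroup ℚ), κ.IsCyclotomic → κ.IsTopGenerator γ → IsCyclotomicVariable 2 γ → let ι := closureEmb (K := ℚ) (v.adicCompletion ℚ); let L := localLayerPointsOfEmb κ ι A; ∀ [NeZero (A.conductorNorm ℤ)] (f : CuspForm (Gamma0 (A.conductorNorm ℤ)) 2), IsNewformOf A f → ∀ (ϖ : ℚ), (ϖ : ℝ) * A.realPeriodRat = plusPeriod f → ∀ (Lplus Lminus : IwasawaAlgebra 2), IsPollackPair f 2 Lplus Lminus → ∀ [ContinuousSMul ℤ_[2] (A.tateModule 2)] (Y : A.FineSelmerDualData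 κ γ), ∀ 𝔭' : PrimeSpectrum (IwasawaAlgebra 2), 𝔭'.asIdeal.height = 1 → PowerSeries.C (2 : ℤ_[2]) ∉ 𝔭'.asIdeal → ∀ (I : Kato2004.IwasawaH1Data A 2 κ γ) (pair : ∀ n : ℕ, H1 (tateRep A 2) (κ.layerSubgroup n) →ₗ[ℤ_[2]] (L n →+ ℤ_[2])), (∀ (n : ℕ) (x : H1 (tateRep A 2) (κ.layerSubgroup (n + 1))) (Q : localPoints A (v.adicCompletion ℚ)) (hQ : Q ∈ L n), pair n (layerCores (tateRep A 2) κ n x) ⟨Q, hQ⟩ = pair (n + 1) x ⟨Q, localLayerPointsOfEmb_mono κ ι A (Nat.le_succ n) hQ⟩) → (∀ (n : ℕ) (g : Field.absoluteGaloisGroup (v.adicCompletion ℚ)) (y : H1 (tateRep A 2) (κ.layerSubgroup n)) (Q : localPoints A (v.adicCompletion ℚ)) (hQ : Q ∈ L n), pair n (conjMap (tateRep A 2).toTopRep (κ.layerSubgroup n) (resGalOfEmb ι g) 1 y) ⟨g • Q, smul_mem_localLayerPointsOfEmb κ ι A n g hQ⟩ = pair n y ⟨Q, hQ⟩) → (∀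 (n k : ℕ) (x : H1 (tateRep A 2) (κ.layerSubgroup n)) (Q : L n), PadicInt.toZModPow k (pair n x Q) = LayerPairing.layerPairingPk A κ v (LayerPairing.weilTowerPk A) (LayerPairing.weilTowerPk_pow A) (LayerPairing.weilTowerPk_add_left A) (LayerPairing.weilTowerPk_add_right A) (LayerPairing.weilTowerPk_smul A) n k x Q) → ∃ (g : Field.absoluteGaloisGroup (v.adicCompletion ℚ)) (_ : κ.IsTopGenerator (resGalOfEmb ι g)) (d : ℕ → localPoints A (v.adicCompletion ℚ)) (s : I.H), (∀ n, d n ∈ L n) ∧ (∀ n, localTraceOfEmb κ ι A (n + 1) (n + 2) (d (n + 2)) = -d n) ∧ (∀ n : ℕ, 1 ≤ n → ∀ P ∈ L n, ∃ B ∈ AddSubgroup.closure (Set.range fun σ : Field.absoluteGaloisGroup (v.adicCompletion ℚ) ↦ σ • d n), ∃ P' ∈ L (n - 1), ∃ R ∈ L n, P = B + P' + 2 • R) ∧ (∀ P ∈ L 0, ∃ a : ℤ, ∃ R ∈ L 0, P = a • d 0 + 2 • R) ∧ (∃ μ ν : IwasawaAlgebra 2, μ ∉ 𝔭'.asIdeal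 ∧ ν ∉ 𝔭'.asIdeal ∧ ∀ n : ℕ, ∃ (m : ℕ) (q : IwasawaAlgebra 2), PowerSeries.C ((2 : ℚ_[2]) ^ m) * (iwasawaToPowerSeries 2 μ * ((mazurTateElement f 2 n).map (algebraMap ℚ ℚ_[2]) : PowerSeries ℚ_[2]) - iwasawaToPowerSeries 2 (ν * pairingSum A (L n) g n (d n) (pair n (I.proj n s)))) = iwasawaToPowerSeries 2 (((cyclotomicOmega 2 n).map (Int.castRingHom ℤ_[2]) : PowerSeries ℤ_[2]) * q)) ∧ Nonempty (Theorems.KatoDescent.KSideDatum I Y s 𝔭')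

-- parent: SignedMainConjectureCMTwoRankZeroOfPubOfFlat · child (gen 1)
/--     item stmt-BirchSwinnertonDyer-28307 · support · rank 302 · closed · proved by Summit.BirchSwinnertonDyer.BirchSwinnertonDyer.Theorems.signedMainConjectureCMTwoRankZeroOfPubOfFlatOfKZ_proof (prover)
    parent: SignedMainConjectureCMTwoRankZeroOfPubOfFlat · by planner
    sources: Kato2004Asterisque, PollackRubin2004, Kobayashi2003, JohnsonLeungKings2011, MilneADT2006
[support — the ONE-HYPOTHESIS CERTIFICATE as an item: K2R0P♭ ⟸ KZ (bridge half of the split; born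
closable by the landed p638949
`Theorems.SignedLowerOffTwo.signedMainConjectureCMTwoRankZeroOfPubOfFlat_of_zetaErlKSide` = p632409
∘ p636500 (registered stub `stub_poitouTateDeepTwo` landed: Kőnig double tower + Rubin B.2.3 + Milne
I 4.10(b) + tree Poitou–Tate), one-liner `fun hKZ ↦ … hKZ`; pen cert KZctxTP2.lean `ofKZ_closer` rc
0, std axioms)] KatoZetaErlKSideCMAtTwoSupply → SignedMainConjectureCMTwoRankZeroOfPubOfFlat: given
Kato's §12/§15 package for f_A at 2, the μ-free CM signed main conjecture at 2 in analytic rank 0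
(Pollack–Rubin 2004 Thm 7.3 at the inert prime 2 minus its μ-part, behind PUB¹⁰ and FLAT) follows —
the port-of-print kernel of the K2 column (length currency doors p609811/p610219, HONDA⁺, Kobayashi
four-term sequence at 2). BSD is not proved by filing this. -/
@[route_item "route-BirchSwinnertonDyer-ThetaPartnerAtTwo"]
def SignedMainConjectureCMTwoRankZeroOfPubOfFlatOfKZ : Prop :=
  KatoZetaErlKSideCMAtTwoSupply → SignedMainConjectureCMTwoRankZeroOfPubOfFlat

-- `SignedMainConjectureCMTwoRankZeroOfPubOfFlatOfKZ` holds: proved by `Summit.BirchSwinnertonDyer.BirchSwinnertonDyer.Theorems.signedMainConjectureCMTwoRankZeroOfPubOfFlatOfKZ_proof` (its module imports this route file, so no `_holds` link can be stated here).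

-- parent: SignedMainConjectureCMTwoRankZeroOfPubOfFlat · glue (gen 1)
/--     item stmt-BirchSwinnertonDyer-28308 · support · rank 303 · closed · proved by Summit.BirchSwinnertonDyer.BirchSwinnertonDyer.Theorems.signedMainConjectureCMTwoRankZeroOfPubOfFlatGlue_proof (prover)
    parent: SignedMainConjectureCMTwoRankZeroOfPubOfFlat · GLUE: children ⟹ parent · by planner
KZ (HOLD, published inputs) and the one-hypothesis certificate K2R0P-flat-of-KZ give K2R0P-flat: fun
h1 h2 => h2 h1 -/
@[route_item "route-BirchSwinnertonDyer-ThetaPartnerAtTwo"]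
def SignedMainConjectureCMTwoRankZeroOfPubOfFlatGlue : Prop :=
  KatoZetaErlKSideCMAtTwoSupply → SignedMainConjectureCMTwoRankZeroOfPubOfFlatOfKZ → SignedMainConjectureCMTwoRankZeroOfPubOfFlat

-- `SignedMainConjectureCMTwoRankZeroOfPubOfFlatGlue` holds: proved by `Summit.BirchSwinnertonDyer.BirchSwinnertonDyer.Theorems.signedMainConjectureCMTwoRankZeroOfPubOfFlatGlue_proof` (its module imports this route file, so no `_holds` link can be stated here).

-- earlier SignedTransportAtTwo (stmt-BirchSwinnertonDyer-20306, replaced 2026-08-27T07:59:14Z -> stmt-BirchSwinnertonDyer-20333): retired by None — ∀ (W : WeierstrassCurve ℚ) [W.IsElliptic] [W.IsGloballyMinimal] (A : WeierstrassCurve ℚ) [A.IsElliptic] [A.IsGloballyMinimal], ¬ W.HasCM → W.analyticRank = 0 → Literature.NumberTheory.EllipticCurves.Rank1Residual.GoodSS W 2 → W.frobeniusTrace 2 = 0 → A.H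
/-- item stmt-BirchSwinnertonDyer-20333 · aside · rank 2 · SPLIT (gen 1) into ResidualLocalTransportAtTwo, LambdaDifferenceAtTwo, MazurTateCongruenceAtTwoR + glue SignedTransportAtTwoGlue · direct attempts still welcome (low priority) · by planner
why it might fail: Kim 2009 Cor 2.13 / EPW Thm 1 are printed for odd p; at 2 the imprimitive local factors at ℓ ∣ N_E·N_A or the period normalisation of L₂^± mod 2 (KO2006: g(0) = 4L/Ω, T+2 ∣ g at a₂ = 0) may carry a 2-power the algebraic side does not see; Matsuno's archimedean condition is vacuous here (Δ < 0).
sources: GreenbergVatsal2000, BDKim2009, EmertonPollackWeston2006, Vatsal1999, Kobayashi2003, arXiv:math/0612317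
[crux] (rev 7: FRAMED by the partner's analytic data) Signed Greenberg–Vatsal transport at p = 2:
for (E, A) on the theta habitat with E[2] ≅ A[2] (Galois-equivariantly), A CM good supersingular at
2 with a₂ = 0, GIVEN a newform f_A of A, its period ratio ϖ_A (ϖ_A·Ω_A = Ω⁺_{f_A}) and a Pollack
pair (L♯_A, L♭_A) of f_A at 2: μ⁺(A) = 0 with X⁺(A) torsion, Kobayashi's `+` main conjecture for A
at 2 and the Kato-side divisibility for E up to a power of 2 imply Kobayashi's `+` main conjecture
for E at 2 (algebraic λ/μ transport à la B. D. Kim 2009 Cor 2.13, analytic congruence of the signed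
2-adic L-functions à la Vatsal/EPW with multiplicity one mod 2, then equal invariants + one
divisibility ⇒ equal ideals). Rev ≤ 6 supplied no (f_A, ϖ_A, Pollack pair), so its hypothesis MC(A)
— a ∀ over those data — was not instantiable from the tree (tp2-p1 audit 2026-08-27T07:33Z; the
tree's only supply `exists_isPollackPair_two` needs L(A,1) ≠ 0); `closes` now produces them from
modularity (hmod A) and L(A,1) ≠ 0 (habitat clause `A.analyticRank = 0`, hLrat A). -/
@[route_item "route-BirchSwinnertonDyer-ThetaPartnerAtTwo"]
def SignedTransportAtTwo : Prop :=
  ∀ (W : WeierstrassCurve ℚ) [W.IsElliptic] [W.IsGloballyMinimal] (A : WeierstrassCurve ℚ) [A.IsElliptic] [A.IsGloballyMinimal], ¬ W.HasCM → W.analyticRank = 0 → Literature.NumberTheory.EllipticCurves.Rank1Residual.GoodSS W 2 → W.frobeniusTrace 2 = 0 → A.HasCM → Literature.NumberTheory.EllipticCurves.Rank1Residual.GoodSS A 2 → A.frobeniusTrace 2 = 0 → (∃ e : WeierstrassCurve.geomTorsion W (2 : ℤ) ≃+ WeierstrassCurve.geomTorsion A (2 : ℤ), ∀ (σ : Field.absoluteGaloisGroup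 ℚ) (P : WeierstrassCurve.geomTorsion W (2 : ℤ)), e (σ • P) = σ • e P) → ∀ [NeZero (A.conductorNorm ℤ)] (fA : CuspForm (CongruenceSubgroup.Gamma0 (A.conductorNorm ℤ)) 2), Literature.NumberTheory.EllipticCurves.ModularForms.IsNewformOf A fA → ∀ (ϖA : ℚ), (ϖA : ℝ) * A.realPeriodRat = Literature.NumberTheory.EllipticCurves.ModularForms.plusPeriod fA → ∀ (LsharpA LflatA : Literature.NumberTheory.EllipticCurves.IwasawaAlgebra 2), Summit.BirchSwinnertonDyer.Rank1Residual.Supersingular.IsPollackPair fA 2 LsharpA LflatA → (∀ (κ : Literature.NumberTheory.EllipticCurves.ZpExtension ℚ 2) (γ : Field.absoluteGaloisGroup ℚ), κ.IsCyclotomic → κ.IsTopGenerator γ → ∀ D : Literature.NumberTheory.EllipticCurves.Kobayashi2003.SignedSelmerDualData A κ γ 1, Module.IsTorsion (Literature.NumberTheory.EllipticCurves.IwasawaAlgebra 2) D.X ∧ D.mu = 0) → Summit.BirchSwinnertonDyer.Rank1Residual.Supersingular.KobayashiMainConjecture A 2 1 → (∀ (κ : Literature.NumberTheory.EllipticCurves.ZpExtension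 ℚ 2) (γ : Field.absoluteGaloisGroup ℚ), κ.IsCyclotomic → κ.IsTopGenerator γ → Literature.NumberTheory.EllipticCurves.IsCyclotomicVariable 2 γ → ∀ [NeZero (W.conductorNorm ℤ)] (f : CuspForm (CongruenceSubgroup.Gamma0 (W.conductorNorm ℤ)) 2), Literature.NumberTheory.EllipticCurves.ModularForms.IsNewformOf W f → ∀ (ϖ : ℚ), (ϖ : ℝ) * W.realPeriodRat = Literature.NumberTheory.EllipticCurves.ModularForms.plusPeriod f → ∀ (Lplus Lminus : Literature.NumberTheory.EllipticCurves.IwasawaAlgebra 2), Summit.BirchSwinnertonDyer.Rank1Residual.Supersingular.IsPollackPair f 2 Lplus Lminus → ∀ (D : Literature.NumberTheory.EllipticCurves.Kobayashi2003.SignedSelmerDualData W κ γ 1), ∃ (g h : Literature.NumberTheory.EllipticCurves.IwasawaAlgebra 2) (m : ℕ), D.charIdeal = Ideal.span {g} ∧ Literature.NumberTheory.EllipticCurves.iwasawaToPowerSeries 2 (g * h) = PowerSeries.C ((2 : ℚ_[2]) ^ m * (ϖ : ℚ_[2])) * Literature.NumberTheory.EllipticCurves.iwasawaToPowerSeries 2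 (Summit.BirchSwinnertonDyer.Rank1Residual.Supersingular.kobayashiL 1 Lplus Lminus)) → Summit.BirchSwinnertonDyer.Rank1Residual.Supersingular.KobayashiMainConjecture W 2 1

-- parent: SignedTransportAtTwo · child (gen 1)
/--     item stmt-BirchSwinnertonDyer-21414 · crux · rank 201 · closed · proved by Summit.BirchSwinnertonDyer.BirchSwinnertonDyer.Theorems.residualLocalTransportAtTwo_proof (prover)
    parent: SignedTransportAtTwo · by planner
    why it might fail: Needs an equivariant map of local points extending the residual isomorphism; the Honda type (ss, a₂ = 0) fixes the formal group up to isomorphism only over unramified extensions of ℚ₂ — on the ramified cyclotomic layers ℚ_{n,2} the ± subgroups of W and A may differ beyond the 2-torsion.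
    sources: Kobayashi2003, BDKim2009, GreenbergVatsal2000, HatleyLei2019
[crux] Local transport at 2 in the currency of local points (bridge v15 stub_sel2Tb): for the
theta-habitat pair (W non-CM, A CM, GoodSS at 2 with a₂ = 0, W[2] ≃ A[2] Galois-equivariantly) and
every Galois-equivariant e′ : W[2^∞][2] ≃ A[2^∞][2], at the place v ∣ 2 there is a
Gal(ℚ̄₂/ℚ₂)-equivariant additive map Ψ : W(ℚ̄₂) → A(ℚ̄₂) restricting to e′ on the 2-torsion — the
input that carries Kobayashi's ± local condition of W[2]-classes to A (U/L0/F of the residual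
devissage are landed theorems p550799/p553187/p553706). -/
@[route_item "route-BirchSwinnertonDyer-ThetaPartnerAtTwo"]
def ResidualLocalTransportAtTwo : Prop :=
  ∀ (W : WeierstrassCurve ℚ) [W.IsElliptic] [W.IsGloballyMinimal] (A : WeierstrassCurve ℚ) [A.IsElliptic] [A.IsGloballyMinimal], ¬ W.HasCM → W.analyticRank = 0 → Literature.NumberTheory.EllipticCurves.Rank1Residual.GoodSS W 2 → W.frobeniusTrace 2 = 0 → A.HasCM → Literature.NumberTheory.EllipticCurves.Rank1Residual.GoodSS A 2 → A.frobeniusTrace 2 = 0 → (∃ e : WeierstrassCurve.geomTorsion W (2 : ℤ) ≃+ WeierstrassCurve.geomTorsion A (2 : ℤ), ∀ (σ : Field.absoluteGaloisGroup ℚ) (P : WeierstrassCurve.geomTorsion W (2 : ℤ)), e (σ • P) = σ • e P) → ∀ (κ : Literature.NumberTheory.EllipticCurves.ZpExtension ℚ 2), κ.IsCyclotomic → ∀ (e' : ↥(AddSubgroup.torsionBy ↥(W.geomPrimaryTorsion 2) (2 : ℤ)) ≃+ ↥(AddSubgroup.torsionBy ↥(A.geomPrimaryTorsion 2) (2 :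 ℤ))) (he' : ∀ (σ : Field.absoluteGaloisGroup ℚ) (x : ↥(AddSubgroup.torsionBy ↥(W.geomPrimaryTorsion 2) (2 : ℤ))), e' (σ • x) = σ • e' x), ∀ (v : IsDedekindDomain.HeightOneSpectrum (NumberField.RingOfIntegers ℚ)), ((2 : ℕ) : NumberField.RingOfIntegers ℚ) ∈ v.asIdeal → ∃ Ψ : Literature.NumberTheory.EllipticCurves.localPoints W (v.adicCompletion ℚ) →+ Literature.NumberTheory.EllipticCurves.localPoints A (v.adicCompletion ℚ), (∀ (τ : Field.absoluteGaloisGroup (v.adicCompletion ℚ)) (P : Literature.NumberTheory.EllipticCurves.localPoints W (v.adicCompletion ℚ)), Ψ (τ • P) = τ • Ψ P) ∧ (∀ x : ↥(AddSubgroup.torsionBy ↥(W.geomPrimaryTorsion 2) (2 : ℤ)), Ψ (Literature.NumberTheory.EllipticCurves.pointsMapOfEmb W (Literature.NumberTheory.EllipticCurves.closureEmb (K := ℚ) (v.adicCompletion ℚ)) ((x : W.geomPrimaryTorsion 2) : W.geomPoints)) = Literature.NumberTheory.EllipticCurves.pointsMapOfEmb A (Literature.NumberTheory.EllipticCurves.closureEmb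 (K := ℚ) (v.adicCompletion ℚ)) ((e' x : A.geomPrimaryTorsion 2) : A.geomPoints))

-- `ResidualLocalTransportAtTwo` holds: proved by `Summit.BirchSwinnertonDyer.BirchSwinnertonDyer.Theorems.residualLocalTransportAtTwo_proof` (its module imports this route file, so no `_holds` link can be stated here).

-- parent: SignedTransportAtTwo · child (gen 1)
/--     item stmt-BirchSwinnertonDyer-21415 · crux · rank 202 · open
    parent: SignedTransportAtTwo · by planner
    why it might fail: Printed for p odd (Greenberg–Vatsal 2000 (10), B.D. Kim 2009 Thm 1.2, Hatley–Lei 2019); at 2 the local terms at v ∈ S₀ need H¹(ℚ_{∞,w}, W[2^∞]) of corank governed by the 2-part of ℓ²−1 (Matsuno 2008) and the archimedean/2-adic classes must not contribute — either defect breaks the identity as typed.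
    sources: GreenbergVatsal2000, BDKim2009, HatleyLei2019, Matsuno2008, Kobayashi2003
[crux] λ-difference identity at 2 with the MATSUNO weights (bridge v15 stub_lam2d): for the habitat
pair and any finite set S₀ of odd places containing the bad places of W and A, λ(X⁻(W)) + Σ_{v∈S₀}
2^{v₂((ℓ_v²−1)/8)}·d_v(W) = λ(X⁻(A)) + Σ_{v∈S₀} 2^{v₂((ℓ_v²−1)/8)}·d_v(A) for torsion signed Selmer
duals with μ = 0 (GV (10) / Kim at p = 2; the odd-p weight sFactor is wrong at 2 for ℓ ≡ 7 mod 8). -/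
@[route_item "route-BirchSwinnertonDyer-ThetaPartnerAtTwo"]
def LambdaDifferenceAtTwo : Prop :=
  ∀ (W : WeierstrassCurve ℚ) [W.IsElliptic] [W.IsGloballyMinimal] (A : WeierstrassCurve ℚ) [A.IsElliptic] [A.IsGloballyMinimal], ¬ W.HasCM → W.analyticRank = 0 → Literature.NumberTheory.EllipticCurves.Rank1Residual.GoodSS W 2 → W.frobeniusTrace 2 = 0 → A.HasCM → Literature.NumberTheory.EllipticCurves.Rank1Residual.GoodSS A 2 → A.frobeniusTrace 2 = 0 → (∃ e : WeierstrassCurve.geomTorsion W (2 : ℤ) ≃+ WeierstrassCurve.geomTorsion A (2 : ℤ), ∀ (σ : Field.absoluteGaloisGroup ℚ) (P : WeierstrassCurve.geomTorsion W (2 : ℤ)), e (σ • P) = σ • e P) → ∀ (κ : Literature.NumberTheory.EllipticCurves.ZpExtension ℚ 2) (γ : Field.absoluteGaloisGroup ℚ), κ.IsCyclotomic → κ.IsTopGenerator γ → ∀ (S₀ : Finset (IsDedekindDomain.HeightOneSpectrum (NumberField.RingOfIntegers ℚ))), (∀ v ∈ S₀, ((2 : ℕ) : NumberField.RingOfIntegers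 ℚ) ∉ v.asIdeal) → (∀ v : IsDedekindDomain.HeightOneSpectrum (NumberField.RingOfIntegers ℚ), ¬ W.HasGoodReductionAt v → v ∈ S₀) → (∀ v : IsDedekindDomain.HeightOneSpectrum (NumberField.RingOfIntegers ℚ), ¬ A.HasGoodReductionAt v → v ∈ S₀) → ∀ (D : Literature.NumberTheory.EllipticCurves.Kobayashi2003.SignedSelmerDualData W κ γ 1) (D' : Literature.NumberTheory.EllipticCurves.Kobayashi2003.SignedSelmerDualData A κ γ 1) [Module.Finite (Literature.NumberTheory.EllipticCurves.IwasawaAlgebra 2) D.X] [Module.Finite (Literature.NumberTheory.EllipticCurves.IwasawaAlgebra 2) D'.X], Module.IsTorsion (Literature.NumberTheory.EllipticCurves.IwasawaAlgebra 2) D.X → Module.IsTorsion (Literature.NumberTheory.EllipticCurves.IwasawaAlgebra 2) D'.X → D.mu = 0 → D'.mu = 0 → Literature.NumberTheory.EllipticCurves.lambdaInvariant 2 D.X + ∑ v ∈ S₀, 2 ^ padicValNat 2 ((Rat.HeightOneSpectrum.natGenerator v ^ 2 - 1) / 8) * Literature.NumberTheory.EllipticCurves.GreenbergVatsal2000.dMultiplicity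 W 2 v = Literature.NumberTheory.EllipticCurves.lambdaInvariant 2 D'.X + ∑ v ∈ S₀, 2 ^ padicValNat 2 ((Rat.HeightOneSpectrum.natGenerator v ^ 2 - 1) / 8) * Literature.NumberTheory.EllipticCurves.GreenbergVatsal2000.dMultiplicity A 2 v

-- parent: SignedTransportAtTwo · child (gen 1)
/--     item stmt-BirchSwinnertonDyer-21416 · crux · rank 203 · open
    parent: SignedTransportAtTwo · by planner
    why it might fail: Vatsal/EPW congruence of MT elements is printed for p odd via multiplicity one mod p on the modular curve; at 2 multiplicity one mod 2 can fail (level structure at 2, Eisenstein-like degeneracies of ρ̄ with image in a 2-group) and the period unit u may depend on the sign/layer parity.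
    sources: Vatsal1999, EmertonPollackWeston2006, PollackWeston2011MT, GreenbergVatsal2000, Pollack2003, Kurihara2002
[crux] Oriented S₀-depleted Mazur–Tate congruence at even layers (bridge v15 stub_V2mtR): with G =
2^m ϖ L♭(W), G_A = 2^{m′} ϖ_A L♭(A) there is a 2-adic unit u such that for every even n, 2^{m′}·(2^m
ϖ θ_n(f)·E_{S₀}(W)⁻¹) − u·2^m·(2^{m′} ϖ_A θ_n(f_A)·E_{S₀}(A)⁻¹) ≡ 0 mod (2^{m+m′+1}, ω_n) in Λ — the
analytic transport of the theta partner through the residual congruence (Vatsal 1999 / EPW 2006 at p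
= 2, inverse-oriented Euler factors; census g7: oriented congruent 20/20). -/
@[route_item "route-BirchSwinnertonDyer-ThetaPartnerAtTwo"]
def MazurTateCongruenceAtTwoR : Prop :=
  ∀ (W : WeierstrassCurve ℚ) [W.IsElliptic] [W.IsGloballyMinimal] (A : WeierstrassCurve ℚ) [A.IsElliptic] [A.IsGloballyMinimal], ¬ W.HasCM → W.analyticRank = 0 → Literature.NumberTheory.EllipticCurves.Rank1Residual.GoodSS W 2 → W.frobeniusTrace 2 = 0 → A.HasCM → Literature.NumberTheory.EllipticCurves.Rank1Residual.GoodSS A 2 → A.frobeniusTrace 2 = 0 → (∃ e : WeierstrassCurve.geomTorsion W (2 : ℤ) ≃+ WeierstrassCurve.geomTorsion A (2 : ℤ), ∀ (σ : Field.absoluteGaloisGroup ℚ) (P : WeierstrassCurve.geomTorsion W (2 : ℤ)), e (σ • P) = σ • e P) → ∀ (γ : Field.absoluteGaloisGroup ℚ), Literature.NumberTheory.EllipticCurves.IsCyclotomicVariable 2 γ → ∀ [NeZero (W.conductorNorm ℤ)] (f : CuspForm (CongruenceSubgroup.Gamma0 (W.conductorNorm ℤ)) 2), Literature.NumberTheory.EllipticCurves.ModularForms.IsNewformOf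 W f → ∀ (ϖ : ℚ), (ϖ : ℝ) * W.realPeriodRat = Literature.NumberTheory.EllipticCurves.ModularForms.plusPeriod f → ∀ (Lplus Lminus : Literature.NumberTheory.EllipticCurves.IwasawaAlgebra 2), Summit.BirchSwinnertonDyer.Rank1Residual.Supersingular.IsPollackPair f 2 Lplus Lminus → ∀ [NeZero (A.conductorNorm ℤ)] (fA : CuspForm (CongruenceSubgroup.Gamma0 (A.conductorNorm ℤ)) 2), Literature.NumberTheory.EllipticCurves.ModularForms.IsNewformOf A fA → ∀ (ϖA : ℚ), (ϖA : ℝ) * A.realPeriodRat = Literature.NumberTheory.EllipticCurves.ModularForms.plusPeriod fA → ∀ (LplusA LminusA : Literature.NumberTheory.EllipticCurves.IwasawaAlgebra 2), Summit.BirchSwinnertonDyer.Rank1Residual.Supersingular.IsPollackPair fA 2 LplusA LminusA → ∀ (S₀ : Finset (IsDedekindDomain.HeightOneSpectrum (NumberField.RingOfIntegers ℚ))), (∀ v ∈ S₀, ((2 : ℕ) : NumberField.RingOfIntegers ℚ) ∉ v.asIdeal) → (∀ v : IsDedekindDomain.HeightOneSpectrum (NumberField.RingOfIntegers ℚ), ¬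 W.HasGoodReductionAt v → v ∈ S₀) → (∀ v : IsDedekindDomain.HeightOneSpectrum (NumberField.RingOfIntegers ℚ), ¬ A.HasGoodReductionAt v → v ∈ S₀) → ∀ (G : Literature.NumberTheory.EllipticCurves.IwasawaAlgebra 2) (m : ℕ), Literature.NumberTheory.EllipticCurves.iwasawaToPowerSeries 2 G = PowerSeries.C ((2 : ℚ_[2]) ^ m * (ϖ : ℚ_[2])) * Literature.NumberTheory.EllipticCurves.iwasawaToPowerSeries 2 (Summit.BirchSwinnertonDyer.Rank1Residual.Supersingular.kobayashiL 1 Lplus Lminus) → ∀ (GA : Literature.NumberTheory.EllipticCurves.IwasawaAlgebra 2) (m' : ℕ), Literature.NumberTheory.EllipticCurves.iwasawaToPowerSeries 2 GA = PowerSeries.C ((2 : ℚ_[2]) ^ m' * (ϖA : ℚ_[2])) * Literature.NumberTheory.EllipticCurves.iwasawaToPowerSeries 2 (Summit.BirchSwinnertonDyer.Rank1Residual.Supersingular.kobayashiL 1 LplusA LminusA) → ∃ u : ℤ_[2]ˣ, ∀ n : ℕ, Even n → ∃ q r : Literature.NumberTheory.EllipticCurves.IwasawaAlgebra 2, PowerSeries.C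 (((2 : ℤ_[2]) ^ m' : ℤ_[2]) : ℚ_[2]) * (PowerSeries.C ((2 : ℚ_[2]) ^ m * (ϖ : ℚ_[2])) * ((Literature.NumberTheory.EllipticCurves.mazurTateElement f 2 n).map (algebraMap ℚ ℚ_[2]) : PowerSeries ℚ_[2]) * Literature.NumberTheory.EllipticCurves.iwasawaToPowerSeries 2 (Literature.NumberTheory.EllipticCurves.GreenbergVatsal2000.eulerFactorProductInv W 2 S₀)) - PowerSeries.C (((u : ℤ_[2]) * (2 : ℤ_[2]) ^ m : ℤ_[2]) : ℚ_[2]) * (PowerSeries.C ((2 : ℚ_[2]) ^ m' * (ϖA : ℚ_[2])) * ((Literature.NumberTheory.EllipticCurves.mazurTateElement fA 2 n).map (algebraMap ℚ ℚ_[2]) : PowerSeries ℚ_[2]) * Literature.NumberTheory.EllipticCurves.iwasawaToPowerSeries 2 (Literature.NumberTheory.EllipticCurves.GreenbergVatsal2000.eulerFactorProductInv A 2 S₀)) = Literature.NumberTheory.EllipticCurves.iwasawaToPowerSeries 2 (PowerSeries.C ((2 : ℤ_[2]) ^ (m + m' + 1)) * q + Literature.NumberTheory.EllipticCurves.Sprung2017.toIwasawa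 2 (Literature.NumberTheory.EllipticCurves.cyclotomicOmega 2 n) * r)

-- parent: SignedTransportAtTwo · glue (gen 1)
/--     item stmt-BirchSwinnertonDyer-21417 · support · rank 204 · closed · proved by Summit.BirchSwinnertonDyer.BirchSwinnertonDyer.Theorems.SignedTransportAtTwo.SplitGlue.signedTransportAtTwoGlue_proof (prover)
    parent: SignedTransportAtTwo · GLUE: children ⟹ parent · by planner
bridge v16 composition (registered skeleton of record on stmt-20333, sha16 9e593aaa9ae27916; stub
texts = v15 d7c94430f981ed48, diff empty): ResidualLocalTransportAtTwo (stub_sel2Tb) →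
LambdaDifferenceAtTwo (stub_lam2d) → MazurTateCongruenceAtTwoR (stub_V2mtR) → SignedTransportAtTwo.
Proof = the lead's kernel-checked `SignedTransportAtTwo_of` of the bridge skeleton with the three
registered stubs as hypotheses (residual devissage U/L0/F landed p550799/p553187/p553706; oriented
analytic binder R-A via eulerFactorProductInv, director W-13 (b)); to be landed by the K1 lead
tp2-p1 as one Theorems file (e.g. ThetaPartnerAtTwoSignedTransportAtTwoSplitGlueV16.lean) and closed
as this glue item. -/
@[route_item "route-BirchSwinnertonDyer-ThetaPartnerAtTwo"]
def SignedTransportAtTwoGlue : Prop :=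
  ResidualLocalTransportAtTwo → LambdaDifferenceAtTwo → MazurTateCongruenceAtTwoR → SignedTransportAtTwo

-- `SignedTransportAtTwoGlue` holds: proved by `Summit.BirchSwinnertonDyer.BirchSwinnertonDyer.Theorems.SignedTransportAtTwo.SplitGlue.signedTransportAtTwoGlue_proof` (its module imports this route file, so no `_holds` link can be stated here).

/-- item stmt-BirchSwinnertonDyer-25797 · crux · rank 2 · SPLIT (gen 1) into PublishedInputsHeckeAtTwo, CuspSpanEvenAtTwoOdd + glue MazurTateCongruenceAtTwoTopGlue · direct attempts still welcome (low priority) · by planner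
why it might fail: Vatsal 1999 / EPW 2006 prove Mazur–Tate/θ-element congruences for ODD p; at p = 2 the S₀-depleted Euler factors, the orientation unit u and the ± period choice can each cost a factor 2, and one stray 2 breaks ≡ 0 mod (2^{m+m′+1}, ω_n) at even layers (census g7: 20/20 congruent, small n).
sources: Vatsal1999, EmertonPollackWeston2006, MazurTate1987, GreenbergVatsal2000, PollackWeston2011
[crux — K1 REPAIR (director W-75 WINDOW 5; tp2-p1 g8 verdict: 20333 SignedTransportAtTwo misstated,
the route only asks K1 at the analytic-rank-0 partner): TOP-LEVEL TWIN of the split child 21416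
`MazurTateCongruenceAtTwoR` (BY NAME — provable by `id` from 21416 and conversely), so that `closes`
can bind it (split children are not admissible binders). Oriented S₀-depleted Mazur–Tate congruence
at even layers: with G = 2^m ϖ L♭(W), G_A = 2^{m′} ϖ_A L♭(A) there is a 2-adic unit u such that for
every even n, 2^{m′}·(2^m ϖ θ_n(f)·E_{S₀}(W)⁻¹) − u·2^m·(2^{m′} ϖ_A θ_n(f_A)·E_{S₀}(A)⁻¹) ≡ 0 mod
(2^{m+m′+1}, ω_n) in Λ — the analytic transport of the theta partner through the residual congruence
(Vatsal 1999 / EPW 2006 at p = 2). With it, K1 at rank 0 (K1Ar) follows from print by p600518 (item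
SignedTransportAtTwoRankZeroOfPub). BSD is not proved by any of this. -/
@[route_item "route-BirchSwinnertonDyer-ThetaPartnerAtTwo", crux]
def MazurTateCongruenceAtTwoTop : Prop :=
  MazurTateCongruenceAtTwoR

-- parent: MazurTateCongruenceAtTwoTop · child (gen 1)
/--     item stmt-BirchSwinnertonDyer-27436 · crux · rank 202 · closed · proved by Summit.BirchSwinnertonDyer.BirchSwinnertonDyer.Theorems.CuspSpanEvenAtTwoOdd_proof (prover)
    parent: MazurTateCongruenceAtTwoTop · by planner
    why it might fail: Open for general odd N: levels with an Eisenstein character mod 2 or extra cusp relations (N = 17, 31, 41, 43, 61, 73 resist the B1 certificate) may carry a period-invariant additive χ killing the 4^k-classes that does not factor through the lower-right entry; one such odd N refutes the ∀N form.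
    sources: Pollack2003, GreenbergVatsal2000, AbbesUllmo1996, AgasheRibetStein2006
[crux — (G′) curve-free FINITE-PER-LEVEL node, SHARED by TP2 K1 (25797), RTT Kan⁺ (20688) and RTT
Kμ⁺-an (21437); = `∀ N odd, Theorems.SignedMuAtTwo.CuspSpanEvenAtTwo N` INLINED (Iff.rfl, cert
W8v2ctx*.lean) so no @[conjecture] leaf is referenced] For every odd level N: every additive χ :
Γ₀(N) → 𝔽₂ that factors through the weight-2 period functionals γ ↦ (h ↦ {∞, γ∞}_h) and vanishes on
all γ with lower-right entry ±4^k (k ≥ 1) is ψ∘(lower-right entry mod N) for a ψ multiplicative on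
units — dually: the even 2-power cusp classes span the kernel of the Shimura-quotient map on
H₁(X₀(N); 𝔽₂). Consumers BY NAME (landed): K1
`MazurTateCongruenceAtTwoR.mazurTateCongruenceAtTwoTop_of_fiveFacts_cuspSpan` (p622986, tp2-p1-w2
g2; recipe tp2-p1 g10 A4), Kan⁺
`ThetaLayerLambdaCongruenceAtTwo.kanP5_of_pub_of_signedMuAnalyticAtTwoPlus` (p618708) ∘
`SignedMuAtTwo.signedMuAnalyticAtTwoPlus_of_abbesUllmo_of_forall_cuspSpanEvenAtTwo`, 21437 likewise.
Evidence: kit-verified for all odd N ≤ 2999 (rtt-p4 lineage) and the habitat⁺ census conductors;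
class-wide THEOREMS at prime powers p^e with (ℤ/p^e)^× = ±⟨4⟩ (Theorem A p618977) and certificates
at 29, 37 (B1 p621005, rtt-p3 g9); strong generation form -/
@[route_item "route-BirchSwinnertonDyer-ThetaPartnerAtTwo", crux]
def CuspSpanEvenAtTwoOdd : Prop :=
  ∀ (N : ℕ) [NeZero N], ¬ 2 ∣ N → ∀ χ : CongruenceSubgroup.Gamma0 N → ZMod 2, (∀ γ δ : CongruenceSubgroup.Gamma0 N, χ (γ * δ) = χ γ + χ δ) → (∀ γ δ : CongruenceSubgroup.Gamma0 N, Literature.NumberTheory.EllipticCurves.ModularForms.periodFunctional N γ = Literature.NumberTheory.EllipticCurves.ModularForms.periodFunctional N δ → χ γ = χ δ) → (∀ γ : CongruenceSubgroup.Gamma0 N, (∃ k : ℕ, 1 ≤ k ∧ ((γ : Matrix.SpecialLinearGroup (Fin 2) ℤ) 1 1).natAbs = 4 ^ k) → χ γ = 0) → ∃ ψ : ZMod N → ZMod 2, (∀ x y : ZMod N, IsUnit x → IsUnit y → ψ (x * y) = ψ x + ψ y) ∧ ∀ γ : CongruenceSubgroup.Gamma0 N, χ γ = ψ ((((γ : Matrix.SpecialLinearGroup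 (Fin 2) ℤ) 1 1 : ℤ) : ZMod N))

-- `CuspSpanEvenAtTwoOdd` holds: proved by `Summit.BirchSwinnertonDyer.BirchSwinnertonDyer.Theorems.CuspSpanEvenAtTwoOdd_proof` (its module imports this route file, so no `_holds` link can be stated here).

-- parent: MazurTateCongruenceAtTwoTop · child (gen 1)
/--     item stmt-BirchSwinnertonDyer-27435 · support · rank 201 · open
    parent: MazurTateCongruenceAtTwoTop · by planner
    sources: AgasheRibetStein2006, ShimuraIATAF1971, DarmonDiamondTaylor1995, Buzzard2000LevelLoweringModTwo, SerreInventiones1972, AbbesUllmo1996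
[support — HOLD, cite-level bundle PUB⁵ of PUBLISHED INPUTS on the Hecke side, SHARED by TP2 K1
(25797) and RTT Kan⁺ (20688) (displayed, never a prover target; director-bsd g13 W8′ 09:58:32Z:
Faltings and Mazur–Kenku DROPPED — tree theorem / unused; the period fact at 2 follows from
Abbes–Ullmo by `SkinnerUrban2014.realPeriodRat_eq_unit_mul_plusPeriod_two_fact_of_abbesUllmo`)]
Eichler–Shimura period lattice of the depleted optimal quotient ∧ Hecke self-duality of
J₀(N)-torsion ∧ Buzzard 2000 multiplicity one mod 2 on Γ₀ ∧ Serre 1972 supersingular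
decomposition-subgroup image ∧ Abbes–Ullmo Thm A (Manin constant). Consumers:
`MazurTateCongruenceAtTwoR.mazurTateCongruenceAtTwoTop_of_fiveFacts_cuspSpan` (p622986),
`ThetaLayerLambdaCongruenceAtTwo.kanP5_of_pub_of_signedMuAnalyticAtTwoPlus` (p618708). Closing =
citing/porting each named fact, not research. -/
@[route_item "route-BirchSwinnertonDyer-ThetaPartnerAtTwo", crux]
def PublishedInputsHeckeAtTwo : Prop :=
  Literature.NumberTheory.EllipticCurves.ModularForms.eichlerShimura_depletedOptimalQuotient_periodLattice_of_dvd ∧ Literature.NumberTheory.EllipticCurves.ModularForms.heckeSelfDual_torsionBy_J0 ∧ Literature.NumberTheory.EllipticCurves.ModularForms.buzzard2000_multiplicityOne_gamma0 ∧ Literature.NumberTheory.EllipticCurves.serre1972_supersingular_decompositionSubgroup_image ∧ Literature.NumberTheory.EllipticCurves.ModularForms.abbesUllmo_not_dvd_maninConstant_of_not_dvd_level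

-- parent: MazurTateCongruenceAtTwoTop · glue (gen 1)
/--     item stmt-BirchSwinnertonDyer-27437 · support · rank 203 · closed · proved by Summit.BirchSwinnertonDyer.BirchSwinnertonDyer.Theorems.MazurTateCongruenceAtTwoR.mazurTateCongruenceAtTwoTopGlue_proof (prover)
    parent: MazurTateCongruenceAtTwoTop · GLUE: children ⟹ parent · by planner
glue for the split of MazurTateCongruenceAtTwoTop: the children imply the parent -/
@[route_item "route-BirchSwinnertonDyer-ThetaPartnerAtTwo"]
def MazurTateCongruenceAtTwoTopGlue : Prop :=
  PublishedInputsHeckeAtTwo → CuspSpanEvenAtTwoOdd → MazurTateCongruenceAtTwoTop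

-- `MazurTateCongruenceAtTwoTopGlue` holds: proved by `Summit.BirchSwinnertonDyer.BirchSwinnertonDyer.Theorems.MazurTateCongruenceAtTwoR.mazurTateCongruenceAtTwoTopGlue_proof` (its module imports this route file, so no `_holds` link can be stated here).

/-- item stmt-BirchSwinnertonDyer-20307 · aside · rank 3 · open · by planner
why it might fail: PollackRubin2004 assumes p > 2 (Rubin's ± decomposition of local units, w_K = 2); at 2 the elliptic-unit index may carry a genuine 2-power, i.e. μ^±(A) > 0 or Char X^± = (2^k·L^±) — then the transport has no μ = 0 source (for A = 27a1 the ANALYTIC μ is 0 in print: KO2006 Rem 0.2(3)).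
sources: PollackRubin2004, Rubin1991, BurungaleFlach2024, arXiv:2206.09874, Pollack2003, KuriharaOtsuki2006
[crux] For every CM curve A/ℚ with good supersingular reduction at 2 and a₂ = 0 (2 inert in the CM
field): X⁺(A/ℚ_∞) is Λ-torsion with μ⁺ = 0 and Kobayashi's `+` main conjecture holds at 2 —
Pollack–Rubin 2004 read at p = 2 on top of the two-variable main conjecture for K at 2
(Johnson-Leung–Kings / Burungale–Flach 2024 Thm 4.1). [difficulty: L] -/
@[route_item "route-BirchSwinnertonDyer-ThetaPartnerAtTwo", crux]
def SignedMainConjectureCMTwo : Prop :=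
  ∀ (A : WeierstrassCurve ℚ) [A.IsElliptic] [A.IsGloballyMinimal], A.HasCM → Literature.NumberTheory.EllipticCurves.Rank1Residual.GoodSS A 2 → A.frobeniusTrace 2 = 0 → (∀ (κ : Literature.NumberTheory.EllipticCurves.ZpExtension ℚ 2) (γ : Field.absoluteGaloisGroup ℚ), κ.IsCyclotomic → κ.IsTopGenerator γ → ∀ D : Literature.NumberTheory.EllipticCurves.Kobayashi2003.SignedSelmerDualData A κ γ 1, Module.IsTorsion (Literature.NumberTheory.EllipticCurves.IwasawaAlgebra 2) D.X ∧ D.mu = 0) ∧ Summit.BirchSwinnertonDyer.Rank1Residual.Supersingular.KobayashiMainConjecture A 2 1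

/-- item stmt-BirchSwinnertonDyer-20312 · aside (kind.auto-crux: conjecture-grade) · rank 3 · open · by planner
why it might fail: PollackRubin2004 Thm 7.3 is printed for p > 2 (± decomposition of local units); at the inert prime 2 the elliptic-unit index or the period ratio ϖ_A may carry a 2-power on some rank-0 CM class (μ⁺ > 0, or char X⁺ = (2^k·L♭), k ≠ 0); analytic μ = 0 is kit-certified on 25 anchors only.
sources: PollackRubin2004, Rubin1991, BurungaleFlach2024, arXiv:2206.09874, Pollack2003, KuriharaOtsuki2006
[crux] (rev 13 = K2 restricted to the instance `closes` consumes; replaces binder K2 20307, which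
stays in the file as an aside) For every CM curve A/ℚ of ANALYTIC RANK 0 with good supersingular
reduction at 2 and a₂ = 0 (2 inert in the CM field): X⁺(A/ℚ_∞) is Λ-torsion with μ⁺ = 0 for every
cyclotomic top-generator pair, and Kobayashi's `+` main conjecture holds at 2 (Néron-normalised,
exact) — Pollack–Rubin 2004 Thm 7.3 read at (p, ε) = (2, +) where L(A,1) ≠ 0 pins the constant term
of every generator of char X⁺(A) (BSD₂(A): Burungale–Flach 2024, tree fact
bsdTriple_of_hasCM_of_L_one_ne_zero), so ONE divisibility (the elliptic-unit / Eisenstein half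
`KobayashiLowerDivisibility A 2 1`) + Kim's control at 2 + torsion + analytic μ = 0 give the whole
statement (tp2-p2 p518019 signedMainConjectureCMTwo_at_rankZero_of_lowerDivisibility; rank-0
sufficiency for closes: p518558). Why it might fail: Pollack–Rubin's ± decomposition of local units
is printed for p > 2; at the inert prime 2 the elliptic-unit index or the period ratio ϖ_A may carry
a genuine 2-power on some rank-0 CM class (μ⁺ > 0, or char X⁺ = (2^k·L♭), k ≠ 0) — kit j273215
certifies ANALYTIC μ = 0 on 25/25 anchors incl. 10 r -/
@[route_item "route-BirchSwinnertonDyer-ThetaPartnerAtTwo"]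
def SignedMainConjectureCMTwoRankZero : Prop :=
  ∀ (A : WeierstrassCurve ℚ) [A.IsElliptic] [A.IsGloballyMinimal], A.HasCM → A.analyticRank = 0 → Literature.NumberTheory.EllipticCurves.Rank1Residual.GoodSS A 2 → A.frobeniusTrace 2 = 0 → (∀ (κ : Literature.NumberTheory.EllipticCurves.ZpExtension ℚ 2) (γ : Field.absoluteGaloisGroup ℚ), κ.IsCyclotomic → κ.IsTopGenerator γ → ∀ D : Literature.NumberTheory.EllipticCurves.Kobayashi2003.SignedSelmerDualData A κ γ 1, Module.IsTorsion (Literature.NumberTheory.EllipticCurves.IwasawaAlgebra 2) D.X ∧ D.mu = 0) ∧ Summit.BirchSwinnertonDyer.Rank1Residual.Supersingular.KobayashiMainConjecture A 2 1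

/-- item stmt-BirchSwinnertonDyer-24945 · support · rank 3 · open · by planner
why it might fail: Twin of 20312 behind its 5 published inputs; fails exactly where K2r0 fails: PollackRubin2004 Thm 7.3 (± local units) is printed for p > 2 — at inert 2 the elliptic-unit index / period ratio ϖ_A may carry a 2-power on some rank-0 CM class (μ⁺ > 0 or char X⁺ = (2^k·L♭), k ≠ 0).
sources: PollackRubin2004, Rubin1991, BurungaleFlach2024, arXiv:2206.09874
[crux] K2r0P = PUB¹⁰ (CM⁵ + Greenberg⁵, = rankzero v8–v12 stub_publishedInputsCMTwo VERBATIM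
(current file afa04601efa59be0)) → K2r0: the TWIN of `SignedMainConjectureCMTwoRankZero`
(stmt-BirchSwinnertonDyer-20312, rev 13 text VERBATIM as the conclusion) behind its ten
published-input antecedents (Burungale–Flach BSD-triple for CM L(A,1) ≠ 0 → modular parametrisation
data → entire L → GZK → the p = 2 period-unit fact →). This is the statement a Theorems file CAN
close: the registered skeleton rankzero (v11/v12: stubs LD± one-sided
`stub_signedLowerDivisibilityUpToTwoPowerNonUnitCMTwo`, μ♭ `stub_analyticMuFlatNonUnitCMTwo`, PUB
`stub_publishedInputsCMTwo`; HONDA⁺(A) proved) proves 20312 BY NAME from its research stubs PLUS the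
cite-only PUB stub `stub_publishedInputsCMTwo` (= exactly these five facts), so 20312 as typed only
ever receives a proof.conditional; the twin moves the five facts into the binders of `closes`
(hPubCM + hmod/hLrat/hGZK). Content: for every CM curve A/ℚ of analytic rank 0, good supersingular
at 2, a₂ = 0: X⁺(A/ℚ_∞) Λ-torsion with μ⁺ = 0 for every cyclotomic top-generator pair, and
Kobayashi's `+` main conjecture at 2 (Pollack–Rubin 2004 Thm 7.3 read at (2,+), -/
@[route_item "route-BirchSwinnertonDyer-ThetaPartnerAtTwo", crux]
def SignedMainConjectureCMTwoRankZeroOfPub : Prop :=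
  Literature.NumberTheory.EllipticCurves.bsdTriple_of_hasCM_of_L_one_ne_zero → Literature.NumberTheory.EllipticCurves.ModularForms.nonempty_modularParametrizationData → WeierstrassCurve.hasEntireLFunction_rat → Literature.NumberTheory.EllipticCurves.rank_eq_analyticRank_of_analyticRank_le_one → Literature.NumberTheory.EllipticCurves.realPeriodRat_eq_unit_mul_plusPeriod_two → Literature.NumberTheory.EllipticCurves.Greenberg1999.casselsSurjectivity_H1Sigma ℚ → Literature.NumberTheory.EllipticCurves.Greenberg1999.prop412_noFiniteSubmodule_H1Sigma_of_rank_one → Literature.NumberTheory.EllipticCurves.Greenberg1999.h1Sigma_zpCorank_le_degree ℚ → Literature.NumberTheory.EllipticCurves.Greenberg1999.localQuotient_restriction_surjective ℚ → Literature.NumberTheory.EllipticCurves.Greenberg1999.h1SigmaInfty_rank_eq_one → ∀ (A : WeierstrassCurve ℚ) [A.IsElliptic] [A.IsGloballyMinimal], A.HasCM → A.analyticRank = 0 → Literature.NumberTheory.EllipticCurves.Rank1Residual.GoodSS A 2 → A.frobeniusTrace 2 = 0 → (∀ (κ : Literature.NumberTheory.EllipticCurves.ZpExtension ℚ 2) (γ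 : Field.absoluteGaloisGroup ℚ), κ.IsCyclotomic → κ.IsTopGenerator γ → ∀ D : Literature.NumberTheory.EllipticCurves.Kobayashi2003.SignedSelmerDualData A κ γ 1, Module.IsTorsion (Literature.NumberTheory.EllipticCurves.IwasawaAlgebra 2) D.X ∧ D.mu = 0) ∧ Summit.BirchSwinnertonDyer.Rank1Residual.Supersingular.KobayashiMainConjecture A 2 1

/-- item stmt-BirchSwinnertonDyer-20308 · aside · rank 4 · open · by planner
why it might fail: Kato Thm 12.5 and Kobayashi Thm 1.3/§8 are printed for p odd; at 2 the signed Coleman map and the Euler-system bound need H¹(ℚ₂(μ_2^∞),T) control where the 2-adic image (RZB) intervenes, and g(0) = 4L/Ω, T+2 ∣ g at a₂ = 0 (Kurihara–Otsuki Cor 1.2) shows where a 2-power m > 0 is forced.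
sources: Kato2004Asterisque, Kobayashi2003, Sprung2017, Sprung2012, KuriharaOtsuki2006
[crux] On the habitat (E non-CM, r_an = 0, good supersingular at 2, a₂ = 0): for every signed Selmer
dual datum, Char X⁺(E/ℚ_∞) = (g) with g·h = 2^m·ϖ·L⁺ for some h ∈ Λ and m ≥ 0 — Kato's Euler-system
divisibility through Kobayashi's `+` Coleman map at p = 2, up to a power of 2 (E[2] absolutely
irreducible is automatic). [difficulty: L] -/
@[route_item "route-BirchSwinnertonDyer-ThetaPartnerAtTwo"]
def SignedKatoDivisibilityUpToAtTwo : Prop :=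
  ∀ (W : WeierstrassCurve ℚ) [W.IsElliptic] [W.IsGloballyMinimal], ¬ W.HasCM → W.analyticRank = 0 → Literature.NumberTheory.EllipticCurves.Rank1Residual.GoodSS W 2 → W.frobeniusTrace 2 = 0 → ∀ (κ : Literature.NumberTheory.EllipticCurves.ZpExtension ℚ 2) (γ : Field.absoluteGaloisGroup ℚ), κ.IsCyclotomic → κ.IsTopGenerator γ → Literature.NumberTheory.EllipticCurves.IsCyclotomicVariable 2 γ → ∀ [NeZero (W.conductorNorm ℤ)] (f : CuspForm (CongruenceSubgroup.Gamma0 (W.conductorNorm ℤ)) 2), Literature.NumberTheory.EllipticCurves.ModularForms.IsNewformOf W f → ∀ (ϖ : ℚ), (ϖ : ℝ) * W.realPeriodRat = Literature.NumberTheory.EllipticCurves.ModularForms.plusPeriod f → ∀ (Lplus Lminus : Literature.NumberTheory.EllipticCurves.IwasawaAlgebra 2), Summit.BirchSwinnertonDyer.Rank1Residual.Supersingular.IsPollackPair f 2 Lplus Lminus → ∀ (D : Literature.NumberTheory.EllipticCurves.Kobayashi2003.SignedSelmerDualData W κ γ 1), ∃ (g h : Literature.NumberTheory.EllipticCurves.IwasawaAlgebra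 2) (m : ℕ), D.charIdeal = Ideal.span {g} ∧ Literature.NumberTheory.EllipticCurves.iwasawaToPowerSeries 2 (g * h) = PowerSeries.C ((2 : ℚ_[2]) ^ m * (ϖ : ℚ_[2])) * Literature.NumberTheory.EllipticCurves.iwasawaToPowerSeries 2 (Summit.BirchSwinnertonDyer.Rank1Residual.Supersingular.kobayashiL 1 Lplus Lminus)

/-- item stmt-BirchSwinnertonDyer-20309 · aside · rank 5 · closed · proved by Summit.BirchSwinnertonDyer.BirchSwinnertonDyer.Theorems.SignedControlAtTwoEulerChar.SignedControlAtTwo_rtt_proof (prover) · by planner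
why it might fail: Kim 2013 Cor 3.15 is printed for odd p; at 2 Kurihara–Otsuki 2006 (Rem 0.2(3), Cor 1.2) give g(0) = 4·L(E,1)/Ω_E and T+2 ∣ g when a₂ = 0 (forced zero at the character of ℚ(√2)): the control identity g(0) ∼ 2^{v₂∏c_ℓ}·#Sel must absorb that 2-power on the chosen sign, else it is off by a factor 4.
sources: Kobayashi2003, BDKim2013, Sprung2012, KuriharaOtsuki2006
[crux] On the habitat: X⁺(E/ℚ_∞) is finitely generated over Λ = ℤ₂⟦T⟧ (Kobayashi Thm 1.2 at 2) and,
when torsion with Char = (g) and Sel finite, g(0) ∼ 2^(v₂ ∏ c_ℓ)·#Sel_2^∞(E/ℚ) (B. D. Kim 2013 Cor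
3.15 at 2) — the two control inputs of the tree's a₂ = 0 door at 2. [difficulty: M] -/
@[route_item "route-BirchSwinnertonDyer-ThetaPartnerAtTwo"]
def SignedControlAtTwo : Prop :=
  ∀ (W : WeierstrassCurve ℚ) [W.IsElliptic] [W.IsGloballyMinimal], ¬ W.HasCM → W.analyticRank = 0 → Literature.NumberTheory.EllipticCurves.Rank1Residual.GoodSS W 2 → W.frobeniusTrace 2 = 0 → (∀ (κ : Literature.NumberTheory.EllipticCurves.ZpExtension ℚ 2) (γ : Field.absoluteGaloisGroup ℚ), κ.IsCyclotomic → κ.IsTopGenerator γ → ∀ D : Literature.NumberTheory.EllipticCurves.Kobayashi2003.SignedSelmerDualData W κ γ 1, Module.Finite (Literature.NumberTheory.EllipticCurves.IwasawaAlgebra 2) D.X) ∧ (∀ (κ : Literature.NumberTheory.EllipticCurves.ZpExtension ℚ 2) (γ : Field.absoluteGaloisGroup ℚ), κ.IsCyclotomic → κ.IsTopGenerator γ → ∀ (D : Literature.NumberTheory.EllipticCurves.Kobayashi2003.SignedSelmerDualData W κ γ 1) [Module.Finite (Literature.NumberTheory.EllipticCurves.IwasawaAlgebra 2) D.X], Module.IsTorsion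 (Literature.NumberTheory.EllipticCurves.IwasawaAlgebra 2) D.X → ∀ g : Literature.NumberTheory.EllipticCurves.IwasawaAlgebra 2, D.charIdeal = Ideal.span {g} → Finite (W.selmerGroupPInfty 2) → ∃ u : ℤ_[2]ˣ, ((PowerSeries.constantCoeff g : ℤ_[2]) : ℚ_[2]) = ((u : ℤ_[2]) : ℚ_[2]) * ((2 : ℕ) : ℚ_[2]) ^ (padicValNat 2 W.tamagawaProduct) * (Nat.card (W.selmerGroupPInfty 2) : ℚ_[2]))

-- `SignedControlAtTwo` holds: proved by `Summit.BirchSwinnertonDyer.BirchSwinnertonDyer.Theorems.SignedControlAtTwoEulerChar.SignedControlAtTwo_rtt_proof` (its module imports this route file, so no `_holds` link can be stated here).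

-- earlier OffThetaHabitatAtTwo (stmt-BirchSwinnertonDyer-20310, replaced 2026-08-27T07:59:14Z -> stmt-BirchSwinnertonDyer-20334): retired by None — ∀ (W : WeierstrassCurve ℚ) [W.IsElliptic] [W.IsGloballyMinimal], ¬ W.HasCM → W.analyticRank ≤ 1 → ¬ (W.analyticRank = 0 ∧ Literature.NumberTheory.EllipticCurves.Rank1Residual.GoodSS W 2 ∧ W.frobeniusTrace 2 = 0 ∧ ∃ (A : WeierstrassCurve ℚ) (_ : A.IsEllip
/-- item stmt-BirchSwinnertonDyer-20334 · aside · rank 6 · open · by planner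
why it might fail: it contains BSD₂ for every non-CM rank-1 curve and every additive-at-2 curve — open; it is the declared residual conjunct of row 1, exactly as hard as row 1 minus the habitat.
sources: Kato2004Asterisque, GreenbergVatsal2000, Matsuno2008
[crux] RESIDUAL (declared; rev 7: habitat clause gains `A.analyticRank = 0`): row 1 off the theta
habitat — every non-CM E of analytic rank ≤ 1 that is NOT (rank 0 ∧ good supersingular at 2 ∧ a₂ = 0
∧ 2-congruent to a CM curve A good supersingular at 2 with a₂(A) = 0 AND L(A,1) ≠ 0) satisfies BSD₂;
carried by route-BirchSwinnertonDyer-ByReductionTypeAtTwo (ordinary / multiplicative / additive /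
rank one / a₂ = ±2) — imported complement, not attacked here. The habitat is unchanged as a set of
classes: all 19 habitat classes of HABITAT-CENSUS-TP2-v1 (N < 5·10⁵, 19/208 X5-supersingular r0
classes) have a RANK-0 CM partner (a D ≡ 1 (mod 4) quadratic twist of the anchor keeps good ss at 2,
a₂ = 0 and A[2]; census v1.1: 15 certified by Cremona allbsd, 4 by explicit out-of-range twists with
L(A,1) ≥ 1.24). -/
@[route_item "route-BirchSwinnertonDyer-ThetaPartnerAtTwo"]
def OffThetaHabitatAtTwo : Prop :=
  ∀ (W : WeierstrassCurve ℚ) [W.IsElliptic] [W.IsGloballyMinimal], ¬ W.HasCM → W.analyticRank ≤ 1 → ¬ (W.analyticRank = 0 ∧ Literature.NumberTheory.EllipticCurves.Rank1Residual.GoodSS W 2 ∧ W.frobeniusTrace 2 = 0 ∧ ∃ (A : WeierstrassCurve ℚ) (_ : A.IsElliptic) (_ : A.IsGloballyMinimal), A.HasCM ∧ A.analyticRank = 0 ∧ Literature.NumberTheory.EllipticCurves.Rank1Residual.GoodSS A 2 ∧ A.frobeniusTrace 2 = 0 ∧ ∃ e : WeierstrassCurve.geomTorsion W (2 : ℤ)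 ≃+ WeierstrassCurve.geomTorsion A (2 : ℤ), ∀ (σ : Field.absoluteGaloisGroup ℚ) (P : WeierstrassCurve.geomTorsion W (2 : ℤ)), e (σ • P) = σ • e P) → Literature.NumberTheory.EllipticCurves.BSDp W 2

/-- item stmt-BirchSwinnertonDyer-19266 · support · rank 9 · open · by planner
sources: BreuilConradDiamondTaylor2001
[support] modularity of E/ℚ as parametrisation data (Breuil–Conrad–Diamond–Taylor 2001 Thm A), BY
NAME — conjunct of OrdPublishedInputsAtTwo (19149; Literature.Uncategorized.OrdPublishedInputsAtTwo
l.26); same content, filed so the head constant is item-stated (#15c one rule; cite_only dep) -/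
@[route_item "route-BirchSwinnertonDyer-ThetaPartnerAtTwo", crux]
def ModularParametrizationSupply : Prop :=
  Literature.NumberTheory.EllipticCurves.ModularForms.nonempty_modularParametrizationData

/-- item stmt-BirchSwinnertonDyer-19273 · aside · rank 9 · open · by planner
sources: BreuilConradDiamondTaylor2001
[support] entire continuation of L(E/ℚ, s) (modularity: Breuil–Conrad–Diamond–Taylor 2001 Thm A +
Hecke/Shimura), BY NAME — conjunct of MultConversePublishedInputsAtTwo (19185); same content, filed
so the head constant is item-stated (#15c one rule; cite_only dep) -/
@[route_item "route-BirchSwinnertonDyer-ThetaPartnerAtTwo"]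
def EntireLFunctionRat : Prop :=
  WeierstrassCurve.hasEntireLFunction_rat

/-- item stmt-BirchSwinnertonDyer-19423 · support (kind.auto-crux: conjecture-grade) · rank 9 · open · by planner
why it might fail: auto-crux — conjecture-grade statement (docstring avows it ('ConjectureCMTwoRankZeroOfPub')); it is open, so it may simply be false
sources: BurungaleFlach2024, arXiv:2206.09874
[support, cite-level BY-NAME ALIAS of a published input — never a prover target; held]
Burungale–Flach 2024 Thm. 1.1 + Cor. 2 (with Rubin 1991 Thm. 12.3 at p ∤ #O_K^×): the full BSD
formula for CM elliptic curves over ℚ with L(E,1) ≠ 0 at EVERY prime p. Conjunct 2 of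
`PublishedInputsFineSelmerCM` (stmt 19387; closes the CM rows of the U₀-ns child); filed under this
split ONLY to item-state the constant (unused by the glue). -/
@[route_item "route-BirchSwinnertonDyer-ThetaPartnerAtTwo", crux]
def BurungaleFlachCMRankZeroSupply : Prop :=
  Literature.NumberTheory.EllipticCurves.bsdTriple_of_hasCM_of_L_one_ne_zero

/-- item stmt-BirchSwinnertonDyer-19921 · support · rank 9 · open · by operator
sources: Kolyvagin1990, GrossZagier1986
[support] The one PUBLISHED input the halves-glue consumes: Gross–Zagier–Kolyvagin, rank = analytic
rank for analytic rank ≤ 1 with Ш finite (tree named fact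
rank_eq_analyticRank_of_analyticRank_le_one; used by bsdp_of_missingPPartAt to turn Miller's last
clause into BSD(E,2)). Carried as a displayed PUB hypothesis; never counted as progress. The further
PRINT of the roads to the two halves (Greenberg Thm-4.1 analogues at a multiplicative prime
thm41Analogue_charValue_rankZero_numberField_anyPrime / …_split_baseChange_anyPrime, modularity) and
the referee-passed MEMO inputs (Kato ⊗ℚ at a multiplicative 2:
X5.O1.KatoMultiplicativeDivisibilityRat W 2, HOME mult/PROOF-MULT.md RC-2; Greenberg–Stevens at 2:
greenberg_stevens W 2, mult/PROOF-GS2.md RC-4) enter the LINES under the halves (bridge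
multiplicativeRankZeroAtTwo_of_muRoad, p409679), not this glue. -/
@[route_item "route-BirchSwinnertonDyer-ThetaPartnerAtTwo", crux]
def RankEqAnalyticRankLeOne : Prop :=
  Literature.NumberTheory.EllipticCurves.rank_eq_analyticRank_of_analyticRank_le_one

/-- item stmt-BirchSwinnertonDyer-20090 · aside · rank 9 · closed · proved by Summit.BirchSwinnertonDyer.BirchSwinnertonDyer.Theorems.ManinLocalTwoThree.AbbesUllmoManinConstantGoodPrimes_proof (prover) · by planner
why it might fail: Published theorem; fails only as a TYPING risk of the Literature statement (hypothesis list / normalisation of the named fact as typed) — D-audit owed.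
sources: AbbesUllmo1996
[support] BY NAME, cite_only input: Abbes–Ullmo 1996 Thm A — for the lattice-optimal datum and p ∤
N, p ∤ c (`abbesUllmo_not_dvd_maninConstant_of_not_dvd_level`); consumed by
`not_dvd_maninConstant_of_kodairaSymbolAt_eq_Istar`. [difficulty: hypothesis-only] -/
@[route_item "route-BirchSwinnertonDyer-ThetaPartnerAtTwo"]
def AbbesUllmoManinConstantInput : Prop :=
  Literature.NumberTheory.EllipticCurves.ModularForms.abbesUllmo_not_dvd_maninConstant_of_not_dvd_level

/-- `AbbesUllmoManinConstantInput` holds: proved by `Summit.BirchSwinnertonDyer.BirchSwinnertonDyer.Theorems.ManinLocalTwoThree.AbbesUllmoManinConstantGoodPrimes_proof`. -/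
theorem AbbesUllmoManinConstantInput_holds : AbbesUllmoManinConstantInput := _root_.Summit.BirchSwinnertonDyer.BirchSwinnertonDyer.Theorems.ManinLocalTwoThree.AbbesUllmoManinConstantGoodPrimes_proof

/-- item stmt-BirchSwinnertonDyer-24143 · support · rank 9 · open · by planner
sources: GreenbergLNM1716, Kato2004Asterisque, Cassels1964ArithmeticVII
[support, print — PUB CONJUNCTION for K4, cite-level BY NAME, VERBATIM the K4 skeleton's PUB stub
`stub_pubGreenbergTwo` (eulerchar v5 ed67af6018b68521): Greenberg LNM 1716 Prop 4.13 / p.122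
(Cassels' surjectivity for H¹_Σ) ∧ Prop 4.12 (no finite Λ-submodule in Λ-rank one) ∧ the corank
bound corank_{ℤ_p} H¹(K_Σ/K, E[p^∞]) ≤ [K:ℚ] (pp.119–120) ∧ surjectivity of restriction on local
quotients (p.108) ∧ weak Leopoldt rank one (§5 p.140 / Kato Thm 12.4) — never a prover target, to be
HELD; PUB binder hPubG of closes v2 (TP2) / v11 (RTT).] -/
@[route_item "route-BirchSwinnertonDyer-ThetaPartnerAtTwo", crux]
def PublishedInputsGreenbergControlAtTwo : Prop :=
  Literature.NumberTheory.EllipticCurves.Greenberg1999.casselsSurjectivity_H1Sigma ℚ ∧ Literature.NumberTheory.EllipticCurves.Greenberg1999.prop412_noFiniteSubmodule_H1Sigma_of_rank_one ∧ Literature.NumberTheory.EllipticCurves.Greenberg1999.h1Sigma_zpCorank_le_degree ℚ ∧ Literature.NumberTheory.EllipticCurves.Greenberg1999.localQuotient_restriction_surjective ℚ ∧ Literature.NumberTheory.EllipticCurves.Greenberg1999.h1SigmaInfty_rank_eq_one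

/-- item stmt-BirchSwinnertonDyer-24262 · aside · rank 9 · open · by planner
sources: GreenbergLNM1716
[support — PUB ALIAS, cite-only, to be HELD, never a prover target] Greenberg 1999 (LNM 1716) Prop.
4.12/4.15: for E/ℚ good ordinary… here as typed in the Literature module
NoProperFiniteIndexSubmoduleH1Sigma — the Σ-restricted H¹ over ℚ_∞ has no proper finite-index
Λ-submodule in corank one. Stated BY NAME so that the cite-only constant appearing in the PUB
conjunction PublishedInputsGreenbergControlAtTwo (24143) and in the antecedents of the twin crux
SignedControlAtTwoOfPub (24144) is item-stated (deps exemption «item-states»; without it the route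
reads staffable NO: 2 unproved cite_only deps after closes v11). BSD is not proved by any of this. -/
@[route_item "route-BirchSwinnertonDyer-ThetaPartnerAtTwo"]
def GreenbergNoFiniteSubmoduleSupply : Prop :=
  Literature.NumberTheory.EllipticCurves.Greenberg1999.prop412_noFiniteSubmodule_H1Sigma_of_rank_one

/-- item stmt-BirchSwinnertonDyer-24263 · aside · rank 9 · open · by planner
sources: GreenbergLNM1716, Kato2004Asterisque
[support — PUB ALIAS, cite-only, to be HELD, never a prover target] Greenberg 1999 (LNM 1716) §4
(structure of H¹_Σ over ℚ_∞): the Λ-rank of H¹(ℚ_Σ/ℚ_∞, E[p^∞]) is one, as typed in the Literature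
module H1SigmaInftyRankOne. Stated BY NAME so that the cite-only constant appearing in 24143 / 24144
is item-stated (deps exemption «item-states»). BSD is not proved by any of this. -/
@[route_item "route-BirchSwinnertonDyer-ThetaPartnerAtTwo"]
def GreenbergH1SigmaInftyRankOneSupply : Prop :=
  Literature.NumberTheory.EllipticCurves.Greenberg1999.h1SigmaInfty_rank_eq_one

/-- item stmt-BirchSwinnertonDyer-24944 · support · rank 9 · closed · proved by Summit.BirchSwinnertonDyer.BirchSwinnertonDyer.Theorems.ThetaPartnerAtTwo.RealPeriodPlusPeriodUnitAtTwoSupply_proof (prover) · by planner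
sources: AbbesUllmo1996, Edixhoven1991, GreenbergVatsal2000
[support, print — PUB SINGLE-FACT ALIAS, cite-level BY NAME: the p = 2 period-unit fact Ω_E = u·Ω⁺_f
with u a 2-adic unit (Manin constant / cℓ-lattice comparison at 2: Abbes–Ullmo 1996, Edixhoven 1991,
Greenberg–Vatsal 2000 §3) — tree fact
`Literature.NumberTheory.EllipticCurves.realPeriodRat_eq_unit_mul_plusPeriod_two` (cite_only,
reviewed p522394). Never a prover target, to be HELD; PUB binder hPer2 of TP2 closes v3, consumed by
the twin K2r0P. -/
@[route_item "route-BirchSwinnertonDyer-ThetaPartnerAtTwo", crux]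
def RealPeriodPlusPeriodUnitAtTwoSupply : Prop :=
  Literature.NumberTheory.EllipticCurves.realPeriodRat_eq_unit_mul_plusPeriod_two

-- `RealPeriodPlusPeriodUnitAtTwoSupply` holds: proved by `Summit.BirchSwinnertonDyer.BirchSwinnertonDyer.Theorems.ThetaPartnerAtTwo.RealPeriodPlusPeriodUnitAtTwoSupply_proof` (its module imports this route file, so no `_holds` link can be stated here).

/-- item stmt-BirchSwinnertonDyer-24946 · support · rank 9 · closed · proved by Summit.BirchSwinnertonDyer.BirchSwinnertonDyer.Theorems.signedControlAtTwoOfPub_tp2_proof (prover) · by planner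
sources: BDKim2013, Kobayashi2003, GreenbergLNM1716, Kato2004Asterisque, Sprung2012, KuriharaOtsuki2006
[support on TP2 (PROVED twin, by name; crux r7 CLOSED on RTT; support here = honest kind for a
proved input and keeps TP2 under the crux cap) — = route ResidualThetaTransportAtTwo item
stmt-BirchSwinnertonDyer-24144 VERBATIM (dedup-attaches; CLOSED·proved by
…Theorems.SignedControlAtTwoOfPub_proof, p592252, 2026-08-28T01:08Z)] K4P = Greenberg⁵ → K4: the
TWIN of `SignedControlAtTwo` (stmt-BirchSwinnertonDyer-20309, text VERBATIM as the conclusion;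
shared with route ResidualThetaTransportAtTwo) behind the five printed Greenberg facts its
registered skeleton eulerchar v5 (ed67af6018b68521, lead tp2-p3 g2) consumes through the cite-only
PUB stub `stub_pubGreenbergTwo` (Cassels 4.13, Prop 4.12, corank bound, local-quotient surjectivity,
weak Leopoldt rank one). As typed, 20309 only ever receives a proof.conditional modulo those facts;
the twin moves them into the PUB binder hPubG of `closes`. Content: on the habitat X⁺(E/ℚ_∞) is
finitely generated over Λ = ℤ₂⟦T⟧ and, when torsion with Char = (g) and Sel finite, g(0) ∼ 2^(v₂ ∏
c_ℓ)·#Sel_2^∞(E/ℚ) (B. D. Kim 2013 Cor 3.15 at 2 via the signed Γ-Euler characteristic; v5: every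
global step a theorem, stubs = LOCAL CYC⁺@2 / LOC⁺@2 / LEV0@2). 2 -/
@[route_item "route-BirchSwinnertonDyer-ThetaPartnerAtTwo", crux]
def SignedControlAtTwoOfPub : Prop :=
  Literature.NumberTheory.EllipticCurves.Greenberg1999.casselsSurjectivity_H1Sigma ℚ → Literature.NumberTheory.EllipticCurves.Greenberg1999.prop412_noFiniteSubmodule_H1Sigma_of_rank_one → Literature.NumberTheory.EllipticCurves.Greenberg1999.h1Sigma_zpCorank_le_degree ℚ → Literature.NumberTheory.EllipticCurves.Greenberg1999.localQuotient_restriction_surjective ℚ → Literature.NumberTheory.EllipticCurves.Greenberg1999.h1SigmaInfty_rank_eq_one → ∀ (W : WeierstrassCurve ℚ) [W.IsElliptic] [W.IsGloballyMinimal], ¬ W.HasCM → W.analyticRank = 0 → Literature.NumberTheory.EllipticCurves.Rank1Residual.GoodSS W 2 → W.frobeniusTrace 2 = 0 → (∀ (κ : Literature.NumberTheory.EllipticCurves.ZpExtension ℚ 2) (γ : Field.absoluteGaloisGroup ℚ), κ.IsCyclotomic → κ.IsTopGenerator γ → ∀ D : Literature.NumberTheory.EllipticCurves.Kobayashi2003.SignedSelmerDualData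 W κ γ 1, Module.Finite (Literature.NumberTheory.EllipticCurves.IwasawaAlgebra 2) D.X) ∧ (∀ (κ : Literature.NumberTheory.EllipticCurves.ZpExtension ℚ 2) (γ : Field.absoluteGaloisGroup ℚ), κ.IsCyclotomic → κ.IsTopGenerator γ → ∀ (D : Literature.NumberTheory.EllipticCurves.Kobayashi2003.SignedSelmerDualData W κ γ 1) [Module.Finite (Literature.NumberTheory.EllipticCurves.IwasawaAlgebra 2) D.X], Module.IsTorsion (Literature.NumberTheory.EllipticCurves.IwasawaAlgebra 2) D.X → ∀ g : Literature.NumberTheory.EllipticCurves.IwasawaAlgebra 2, D.charIdeal = Ideal.span {g} → Finite (W.selmerGroupPInfty 2) → ∃ u : ℤ_[2]ˣ, ((PowerSeries.constantCoeff g : ℤ_[2]) : ℚ_[2]) = ((u : ℤ_[2]) : ℚ_[2]) * ((2 : ℕ) : ℚ_[2]) ^ (padicValNat 2 W.tamagawaProduct) * (Nat.card (W.selmerGroupPInfty 2) : ℚ_[2]))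

-- `SignedControlAtTwoOfPub` holds: proved by `Summit.BirchSwinnertonDyer.BirchSwinnertonDyer.Theorems.signedControlAtTwoOfPub_tp2_proof` (its module imports this route file, so no `_holds` link can be stated here).

/-- item stmt-BirchSwinnertonDyer-25632 · support · rank 9 · open · by planner
sources: Kato2004Asterisque, Greenberg1989, GreenbergLNM1716
[support, print — PUB SINGLE-FACT ALIAS, cite-level BY NAME, HELD after filing: Kato 2004 Astérisque
295 Thm 13.4(2) at p = 2 for T₂W, print-exact contragredient form
(`Literature.NumberTheory.EllipticCurves.Kato2004.thm13_4_two_lengthAt_fineSelmerDualContra_le_of_isEulerSystemClassTwo`,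
p599770): for ¬CM W, cyclotomic (κ, γ), every pinned I : IwasawaH1Data W 2 κ γ, FB :
FineSelmerDualData κ γ⁻¹ and every genuine 2-adic Euler-system class s ≠ 0, at every height-one 𝔭 ∌
2: ℓ_𝔭(X₀) ≤ ℓ_𝔭(𝐇¹/Λs). Never a prover target (no `_holds`, size XL); exempts the cite_only fact
for `staffable`; binder hKES of closes.] -/
@[route_item "route-BirchSwinnertonDyer-ThetaPartnerAtTwo", crux]
def KatoEulerSystemBoundContraAtTwoSupply : Prop :=
  Literature.NumberTheory.EllipticCurves.Kato2004.thm13_4_two_lengthAt_fineSelmerDualContra_le_of_isEulerSystemClassTwo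

/-- item stmt-BirchSwinnertonDyer-25785 · support (kind.auto-crux: conjecture-grade) · rank 9 · closed · proved by Summit.BirchSwinnertonDyer.BirchSwinnertonDyer.Theorems.signedTransportAtTwoRankZeroOfPub_proof (prover) · by planner
why it might fail: auto-crux — conjecture-grade statement (statement references the registered conjecture Summit.BirchSwinnertonDyer.Rank1Residual.Supersingular.KobayashiMainConjecture); it is open, so it may simply be false
sources: Greenberg1999, Kobayashi2003, Vatsal1999, EmertonPollackWeston2006
[support — K1P, PHASE-T pattern (as K2r0P / K4P / K3P′): K1 AT ANALYTIC RANK 0 FROM ITS PUBLISHED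
INPUTS; text = lead tp2-p1 g8's K1P-text.txt verbatim] conjuncts 1, 2, 3, 5 of
`PublishedInputsGreenbergControlAtTwo` (Greenberg 1999: Cassels surjectivity for H¹_Σ, Prop. 4.12 no
finite Λ-submodule at corank one, corank ≤ degree, H¹_Σ,∞ rank one) BY NAME → GZK
(`rank_eq_analyticRank_of_analyticRank_le_one`) BY NAME → `MazurTateCongruenceAtTwoR` (21416) BY
NAME → K1Ar := the text of `SignedTransportAtTwo` (20333) with `A.analyticRank = 0 →` inserted after
the `¬ A.HasCM` binder, verbatim otherwise. PROVED by one line over the landed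
`Theorems.SignedTransportAtTwo.signedTransportAtTwo_rankZero_of_print4` (p600518): `fun hG1 hG2 hG3
hG5 hGZK hMT => signedTransportAtTwo_rankZero_of_print4 hG1 hG2 hG3 hG5 hGZK hMT` (cert HOME
bsd-wall-tp2-p1/K1P-cert.lean). Binder hK1P of closes v3rk. BSD is not proved by any of this. -/
@[route_item "route-BirchSwinnertonDyer-ThetaPartnerAtTwo", crux]
def SignedTransportAtTwoRankZeroOfPub : Prop :=
  Literature.NumberTheory.EllipticCurves.Greenberg1999.casselsSurjectivity_H1Sigma ℚ → Literature.NumberTheory.EllipticCurves.Greenberg1999.prop412_noFiniteSubmodule_H1Sigma_of_rank_one → Literature.NumberTheory.EllipticCurves.Greenberg1999.h1Sigma_zpCorank_le_degree ℚ → Literature.NumberTheory.EllipticCurves.Greenberg1999.h1SigmaInfty_rank_eq_one → Literature.NumberTheory.EllipticCurves.rank_eq_analyticRank_of_analyticRank_le_one → Summit.BirchSwinnertonDyer.BirchSwinnertonDyer.Theses.ThetaPartnerAtTwo.MazurTateCongruenceAtTwoR → ∀ (W : WeierstrassCurve ℚ) [W.IsElliptic] [W.IsGloballyMinimal] (A :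 WeierstrassCurve ℚ) [A.IsElliptic] [A.IsGloballyMinimal], ¬ W.HasCM → W.analyticRank = 0 → Literature.NumberTheory.EllipticCurves.Rank1Residual.GoodSS W 2 → W.frobeniusTrace 2 = 0 → A.HasCM → A.analyticRank = 0 → Literature.NumberTheory.EllipticCurves.Rank1Residual.GoodSS A 2 → A.frobeniusTrace 2 = 0 → (∃ e : WeierstrassCurve.geomTorsion W (2 : ℤ) ≃+ WeierstrassCurve.geomTorsion A (2 : ℤ), ∀ (σ : Field.absoluteGaloisGroup ℚ) (P : WeierstrassCurve.geomTorsion W (2 : ℤ)), e (σ • P) = σ • e P) → ∀ [NeZero (A.conductorNorm ℤ)] (fA : CuspForm (CongruenceSubgroup.Gamma0 (A.conductorNorm ℤ)) 2), Literature.NumberTheory.EllipticCurves.ModularForms.IsNewformOf A fA → ∀ (ϖA : ℚ), (ϖA : ℝ) * A.realPeriodRat = Literature.NumberTheory.EllipticCurves.ModularForms.plusPeriod fA → ∀ (LsharpA LflatA : Literature.NumberTheory.EllipticCurves.IwasawaAlgebra 2), Summit.BirchSwinnertonDyer.Rank1Residual.Supersingular.IsPollackPair fA 2 LsharpA LflatA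 → (∀ (κ : Literature.NumberTheory.EllipticCurves.ZpExtension ℚ 2) (γ : Field.absoluteGaloisGroup ℚ), κ.IsCyclotomic → κ.IsTopGenerator γ → ∀ D : Literature.NumberTheory.EllipticCurves.Kobayashi2003.SignedSelmerDualData A κ γ 1, Module.IsTorsion (Literature.NumberTheory.EllipticCurves.IwasawaAlgebra 2) D.X ∧ D.mu = 0) → Summit.BirchSwinnertonDyer.Rank1Residual.Supersingular.KobayashiMainConjecture A 2 1 → (∀ (κ : Literature.NumberTheory.EllipticCurves.ZpExtension ℚ 2) (γ : Field.absoluteGaloisGroup ℚ), κ.IsCyclotomic → κ.IsTopGenerator γ → Literature.NumberTheory.EllipticCurves.IsCyclotomicVariable 2 γ → ∀ [NeZero (W.conductorNorm ℤ)] (f : CuspForm (CongruenceSubgroup.Gamma0 (W.conductorNorm ℤ)) 2), Literature.NumberTheory.EllipticCurves.ModularForms.IsNewformOf W f → ∀ (ϖ : ℚ), (ϖ : ℝ) * W.realPeriodRat = Literature.NumberTheory.EllipticCurves.ModularForms.plusPeriod f → ∀ (Lplus Lminus : Literature.NumberTheory.EllipticCurves.IwasawaAlgebra 2), Summit.BirchSwinnertonDyer.Rank1Residual.Supersingular.IsPollackPair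 f 2 Lplus Lminus → ∀ (D : Literature.NumberTheory.EllipticCurves.Kobayashi2003.SignedSelmerDualData W κ γ 1), ∃ (g h : Literature.NumberTheory.EllipticCurves.IwasawaAlgebra 2) (m : ℕ), D.charIdeal = Ideal.span {g} ∧ Literature.NumberTheory.EllipticCurves.iwasawaToPowerSeries 2 (g * h) = PowerSeries.C ((2 : ℚ_[2]) ^ m * (ϖ : ℚ_[2])) * Literature.NumberTheory.EllipticCurves.iwasawaToPowerSeries 2 (Summit.BirchSwinnertonDyer.Rank1Residual.Supersingular.kobayashiL 1 Lplus Lminus)) → Summit.BirchSwinnertonDyer.Rank1Residual.Supersingular.KobayashiMainConjecture W 2 1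

-- `SignedTransportAtTwoRankZeroOfPub` holds: proved by `Summit.BirchSwinnertonDyer.BirchSwinnertonDyer.Theorems.signedTransportAtTwoRankZeroOfPub_proof` (its module imports this route file, so no `_holds` link can be stated here).

/-- item stmt-BirchSwinnertonDyer-27793 · aside · rank 9 · closed · proved by Summit.BirchSwinnertonDyer.BirchSwinnertonDyer.Theorems.InputsSweep.thetaPartnerAtTwo_serreSupersingularDecompositionImageInput_proof (prover) · by planner
why it might fail: Published theorem; fails only as a TYPING risk of the Literature statement (hypothesis list / normalisation of the named fact as typed) — D-audit owed.
sources: SerreInventiones1972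
[aside — HOLD input alias] published theorem Serre 1972 (Invent. Math. 15) Prop. 12 / §1.11:
supersingular mod-p decomposition-subgroup image; single-fact alias of the Literature named fact
`Literature.NumberTheory.EllipticCurves.serre1972_supersingular_decompositionSubgroup_image`
(cite_only until D-audited), consumed ONLY via the PUB⁵ bundle stmt-BirchSwinnertonDyer-27435
`PublishedInputsHeckeAtTwo`; declared as an item so the cone dependency is an item (gate5 12:02Z via
director-bsd g13 12:06:28Z, REMEDY A execution path); held-copy status per PROMOTE-PUB5-HELDCOPY.md;
never a prover target. -/
@[route_item "route-BirchSwinnertonDyer-ThetaPartnerAtTwo"]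
def SerreSupersingularDecompositionImageInput : Prop :=
  Literature.NumberTheory.EllipticCurves.serre1972_supersingular_decompositionSubgroup_image

-- `SerreSupersingularDecompositionImageInput` holds: proved by `Summit.BirchSwinnertonDyer.BirchSwinnertonDyer.Theorems.InputsSweep.thetaPartnerAtTwo_serreSupersingularDecompositionImageInput_proof` (its module imports this route file, so no `_holds` link can be stated here).

/-- item stmt-BirchSwinnertonDyer-27798 · aside · rank 9 · open · by planner
why it might fail: Published theorem; fails only as a TYPING risk of the Literature statement (hypothesis list / normalisation of the named fact as typed) — D-audit owed.
sources: Buzzard2000LevelLoweringModTwo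
[aside — HOLD input alias] published theorem Buzzard 2000 (appendix to Ribet–Stein / J. reine
angew.) multiplicity one at 2 on Γ₀; single-fact alias of the Literature named fact
`Literature.NumberTheory.EllipticCurves.ModularForms.buzzard2000_multiplicityOne_gamma0` (cite_only
until D-audited), consumed ONLY via the PUB⁵ bundle stmt-BirchSwinnertonDyer-27435
`PublishedInputsHeckeAtTwo`; declared as an item so the cone dependency is an item (gate5 12:02Z via
director-bsd g13 12:06:28Z, REMEDY A execution path); held-copy status per PROMOTE-PUB5-HELDCOPY.md;
never a prover target. -/
@[route_item "route-BirchSwinnertonDyer-ThetaPartnerAtTwo"]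
def BuzzardMultiplicityOneGammaZeroInput : Prop :=
  Literature.NumberTheory.EllipticCurves.ModularForms.buzzard2000_multiplicityOne_gamma0

/-- item stmt-BirchSwinnertonDyer-27799 · aside · rank 9 · closed · proved by Summit.BirchSwinnertonDyer.BirchSwinnertonDyer.Theorems.InputsSweep.thetaPartnerAtTwo_eichlerShimuraDepletedOptimalQuotientInput_proof (prover) · by planner
why it might fail: Published theorem; fails only as a TYPING risk of the Literature statement (hypothesis list / normalisation of the named fact as typed) — D-audit owed.
sources: ShimuraIATAF1971
[aside — HOLD input alias] published theorem Eichler–Shimura: period lattice of the (p-depleted)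
optimal quotient, Shimura IATAF 1971 Thm 7.14 / Agashe–Ribet–Stein 2006 §2; single-fact alias of the
Literature named fact
`Literature.NumberTheory.EllipticCurves.ModularForms.eichlerShimura_depletedOptimalQuotient_periodLattice_of_dvd`
(cite_only until D-audited), consumed ONLY via the PUB⁵ bundle stmt-BirchSwinnertonDyer-27435
`PublishedInputsHeckeAtTwo`; declared as an item so the cone dependency is an item (gate5 12:02Z via
director-bsd g13 12:06:28Z, REMEDY A execution path); held-copy status per PROMOTE-PUB5-HELDCOPY.md;
never a prover target. -/
@[route_item "route-BirchSwinnertonDyer-ThetaPartnerAtTwo"]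
def EichlerShimuraDepletedOptimalQuotientInput : Prop :=
  Literature.NumberTheory.EllipticCurves.ModularForms.eichlerShimura_depletedOptimalQuotient_periodLattice_of_dvd

-- `EichlerShimuraDepletedOptimalQuotientInput` holds: proved by `Summit.BirchSwinnertonDyer.BirchSwinnertonDyer.Theorems.InputsSweep.thetaPartnerAtTwo_eichlerShimuraDepletedOptimalQuotientInput_proof` (its module imports this route file, so no `_holds` link can be stated here).

/-- item stmt-BirchSwinnertonDyer-27800 · aside · rank 9 · closed · proved by Summit.BirchSwinnertonDyer.BirchSwinnertonDyer.Theorems.HeckeSelfDualTorsionJ0Input_proof (prover) · by planner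
why it might fail: Published theorem; fails only as a TYPING risk of the Literature statement (hypothesis list / normalisation of the named fact as typed) — D-audit owed.
sources: DarmonDiamondTaylor1995
[aside — HOLD input alias] published theorem Hecke self-duality of J₀(N)[m]-torsion,
Darmon–Diamond–Taylor 1995 §1.7 / Tilouine, Emerton 2002; single-fact alias of the Literature named
fact `Literature.NumberTheory.EllipticCurves.ModularForms.heckeSelfDual_torsionBy_J0` (cite_only
until D-audited), consumed ONLY via the PUB⁵ bundle stmt-BirchSwinnertonDyer-27435
`PublishedInputsHeckeAtTwo`; declared as an item so the cone dependency is an item (gate5 12:02Z via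
director-bsd g13 12:06:28Z, REMEDY A execution path); held-copy status per PROMOTE-PUB5-HELDCOPY.md;
never a prover target. -/
@[route_item "route-BirchSwinnertonDyer-ThetaPartnerAtTwo"]
def HeckeSelfDualTorsionJ0Input : Prop :=
  Literature.NumberTheory.EllipticCurves.ModularForms.heckeSelfDual_torsionBy_J0

-- `HeckeSelfDualTorsionJ0Input` holds: proved by `Summit.BirchSwinnertonDyer.BirchSwinnertonDyer.Theorems.HeckeSelfDualTorsionJ0Input_proof` (its module imports this route file, so no `_holds` link can be stated here).

/-- item stmt-BirchSwinnertonDyer-23110 · aside · rank 205 · open · by planner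
why it might fail: Unprinted at p = 2: GreenbergVatsal2000 Prop 2.8/(10) and BDKim2009 Cor 2.13 take p odd; at 2 the + condition on E[2]-classes must be ρ̄|G_ℚ₂-determined and X⁺ must have no finite Λ-submodule (Kobayashi2003 Thm 1.2 is p odd); c must be uniform in E — an E-dependent 2-power defect breaks it.
sources: GreenbergVatsal2000, BDKim2009, Matsuno2008, Kobayashi2003, HatleyLei2019
[crux — RLF⁻ = the registered stub `stub_rlf2` of line `bridge` v18 (skeleton b0e9c7ae4e89a92d) on
K1 20333, verbatim up to FQN spelling (certificate CertRLF.lean: `rlfItem_iff_stub := Iff.rfl`)]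
Greenberg–Vatsal residual λ-formula at p = 2 on the Δ < 0 branch of the habitat: for the cyclotomic
ℤ₂-extension (κ, γ) and a finite set S₀ of odd places there is a constant c = c(κ, γ, S₀) such that
for EVERY globally minimal E/ℚ good supersingular at 2 with a₂ = 0, Δ_E < 0 and all bad places in
S₀, and every finitely generated Λ-torsion + signed Selmer dual D with μ = 0: #{S₀-non-primitive
residual + Selmer classes of E[2] over ℚ_∞ (unramified outside S₀, trivial at ∞, + Kummer condition
at 2 from the signed local points)} = 2 ^ (λ(D.X) + Σ_{v ∈ S₀} 2^{v₂((ℓ_v² − 1)/8)} · d_v(E, 2) +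
c). On Δ < 0 no archimedean condition survives (H¹(ℝ, E[2^∞]) = 0; Matsuno 2008 types his 2-adic
λ-transport there for the same reason). USE: implies child 21415 `LambdaDifferenceAtTwo` BY NAME via
the landed reduction `Theorems.SignedTransportAtTwo.lam2d_of_residualLambdaFormula_negDisc`
(p573850): W[2] ≃ A[2] equivariant ⇒ same left side ⇒ λ⁺_W − λ⁺_A = Σ_v (d_v(W) − d_v(A))·2^{…}.
21415 stays as the secon -/
@[route_item "route-BirchSwinnertonDyer-ThetaPartnerAtTwo", crux]
def ResidualLambdaFormulaNegDiscAtTwo : Prop :=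
  ∀ (κ : Literature.NumberTheory.EllipticCurves.ZpExtension ℚ 2) (γ : Field.absoluteGaloisGroup ℚ), κ.IsCyclotomic → κ.IsTopGenerator γ → ∀ (S₀ : Finset (IsDedekindDomain.HeightOneSpectrum (NumberField.RingOfIntegers ℚ))), (∀ v ∈ S₀, ((2 : ℕ) : NumberField.RingOfIntegers ℚ) ∉ v.asIdeal) → ∃ c : ℕ, ∀ (E : WeierstrassCurve ℚ) [E.IsElliptic] [E.IsGloballyMinimal], Literature.NumberTheory.EllipticCurves.Rank1Residual.GoodSS E 2 → E.frobeniusTrace 2 = 0 → E.Δ < 0 → (∀ v : IsDedekindDomain.HeightOneSpectrum (NumberField.RingOfIntegers ℚ), ¬ E.HasGoodReductionAt v → v ∈ S₀) → ∀ (D : Literature.NumberTheory.EllipticCurves.Kobayashi2003.SignedSelmerDualData E κ γ 1) [Module.Finite (Literature.NumberTheory.EllipticCurves.IwasawaAlgebra 2) D.X], Module.IsTorsion (Literature.NumberTheory.EllipticCurves.IwasawaAlgebra 2) D.X → D.mu = 0 → {x : Literature.NumberTheory.EllipticCurves.subgroupH1 κ.kerSubgroup ↥(AddSubgroup.torsionBy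 ↥(E.geomPrimaryTorsion 2) (2 : ℤ)) | x ∈ Literature.NumberTheory.EllipticCurves.GreenbergVatsal2000.unramifiedOutside κ.kerSubgroup ↥(AddSubgroup.torsionBy ↥(E.geomPrimaryTorsion 2) (2 : ℤ)) 2 (↑S₀ : Set (IsDedekindDomain.HeightOneSpectrum (NumberField.RingOfIntegers ℚ))) ∧ (∀ (w : NumberField.InfinitePlace ℚ) (σ : Field.absoluteGaloisGroup ℚ), Literature.NumberTheory.EllipticCurves.conjH1 κ.kerSubgroup ↥(AddSubgroup.torsionBy ↥(E.geomPrimaryTorsion 2) (2 : ℤ)) σ x ∈ Literature.NumberTheory.EllipticCurves.GreenbergSelmer.infKer κ.kerSubgroup ↥(AddSubgroup.torsionBy ↥(E.geomPrimaryTorsion 2) (2 : ℤ)) w) ∧ (∀ (v : IsDedekindDomain.HeightOneSpectrum (NumberField.RingOfIntegers ℚ)), ((2 : ℕ) : NumberField.RingOfIntegers ℚ) ∈ v.asIdeal → ∀ σ : Field.absoluteGaloisGroup ℚ, E.conjH1 2 κ.kerSubgroup σ (Literature.NumberTheory.EllipticCurves.GreenbergVatsal2000.pushH1 κ.kerSubgroup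 (AddSubgroup.torsionBy ↥(E.geomPrimaryTorsion 2) (2 : ℤ)).subtype (fun _ _ ↦ rfl) x) ∈ Literature.NumberTheory.EllipticCurves.Kobayashi2003.localKummerOverOfEmb E 2 κ.kerSubgroup (Literature.NumberTheory.EllipticCurves.closureEmb (K := ℚ) (v.adicCompletion ℚ)) (⨆ n : ℕ, Literature.NumberTheory.EllipticCurves.Kobayashi2003.signedLocalPoints κ (v.adicCompletion ℚ) E 1 n))}.ncard = 2 ^ (Literature.NumberTheory.EllipticCurves.lambdaInvariant 2 D.X + ∑ v ∈ S₀, 2 ^ padicValNat 2 ((Rat.HeightOneSpectrum.natGenerator v ^ 2 - 1) / 8) * Literature.NumberTheory.EllipticCurves.GreenbergVatsal2000.dMultiplicity E 2 v + c)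

/-- item stmt-BirchSwinnertonDyer-20311 · assembly · rank 1 · closed · proved by Summit.BirchSwinnertonDyer.BirchSwinnertonDyer.Theorems.thetaPartnerAtTwo_assembly_proof (prover) · by planner
sources: Kobayashi2003, BDKim2013
[assembly] PUB supports → SignedTransportAtTwo → SignedMainConjectureCMTwo →
SignedKatoDivisibilityUpToAtTwo → SignedControlAtTwo → OffThetaHabitatAtTwo → row 1 `NonCMAtTwo`
(the statement of `closes`). -/
@[route_item "route-BirchSwinnertonDyer-ThetaPartnerAtTwo"]
def Assembly : Prop :=
  ModularParametrizationSupply → EntireLFunctionRat → RankEqAnalyticRankLeOne → SignedTransportAtTwo → SignedMainConjectureCMTwo → SignedKatoDivisibilityUpToAtTwo → SignedControlAtTwo → OffThetaHabitatAtTwo → Summit.BirchSwinnertonDyer.BirchSwinnertonDyer.Rank1Residual.NonCMAtTwo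

-- `Assembly` holds: proved by `Summit.BirchSwinnertonDyer.BirchSwinnertonDyer.Theorems.thetaPartnerAtTwo_assembly_proof` (its module imports this route file, so no `_holds` link can be stated here).

/-! D-0027 §2.1 — DECIDING THEOREM (planner-authored via `route open/edit --closes-file`; by planner-bsd-wall-p2-g17-0 2026-08-28T16:21:34Z):
its hypotheses are this route's items and its conclusion the registered leaf `Summit.BirchSwinnertonDyer.WAllNonCMAtTwoThetaHabitat` (rung W-ALL/1.hab, D-0061) (glue_lint), and it elaborates with this file. -/

@[closes "route-BirchSwinnertonDyer-ThetaPartnerAtTwo"] theorem closes (hmod : ModularParametrizationSupply)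
    (hGZK : RankEqAnalyticRankLeOne) (hBF : BurungaleFlachCMRankZeroSupply)
    (hPer2 : RealPeriodPlusPeriodUnitAtTwoSupply) (hPubG : PublishedInputsGreenbergControlAtTwo)
    (hMTt : MazurTateCongruenceAtTwoTop) (hK1P : SignedTransportAtTwoRankZeroOfPub)
    (hCMPf : SignedMainConjectureCMTwoRankZeroOfPubOfFlat) (hFlat : AnalyticMuFlatCMTwoRankZero)
    (hKES : KatoEulerSystemBoundContraAtTwoSupply) (hKatoP : SignedKatoDivisibilityUpToAtTwoOfPub) (hStrP : SignedControlAtTwoOfPub) :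
    Summit.BirchSwinnertonDyer.WAllNonCMAtTwoThetaHabitat := by
  -- displayed-inputs collapse (bsd-inputs-r2-p1 p609088, ROUTE-FREE module PublishedInputsOfNewform): 19273 EntireLFunctionRat
  -- BY NAME from the one modularity input 19266 (BCDT Thm A (6) ⇒ (2) + Hecke, Diamond–Shurman 5.10.2/8.8.3); hLrat leaves the binder list
  have hLrat : EntireLFunctionRat := Summit.BirchSwinnertonDyer.BirchSwinnertonDyer.Theorems.PublishedInputsOfNewform.entireLFunctionRat_of_modularParametrization hmod
  -- K1 REPAIR (director W-75 WINDOW 5; tp2-p1 g8 verdict misstated, p600518 + p601303): K1 is asked only at the rank-0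
  -- partner: K1Ar := hK1P at conjuncts 1,2,3,5 of hPubG, GZK and the Mazur–Tate congruence (top-level twin binder hMTt)
  -- K3R2(c′) (director W-73 (1) GO-ON-RETYPE; print-exact Kato 13.4(2)@2 fact p599770 in tree): K3 BY NAME from the
  -- PUB binder hKES (Kato's theorem, cite-level) and GZK via the twin K3P (research content = R2^ι, certificate p600818)
  have hKato : SignedKatoDivisibilityUpToAtTwo := hKatoP hKES hGZK
  -- PHASE T (reduced, T11r): K2r0 and K4 BY NAME from their published inputs (PUB binders) via the twins K2r0P / K4P; K3 (20308) stays a binder pending the K2 named-fact audit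
  obtain ⟨hG1, hG2, hG3, hG4, hG5⟩ := hPubG
  -- K2R0P♭ (director W-78 (c) GO-ON-FREEZE; lead tp2-p2 g8 FREEZE 06:49:03Z, K2r0PFlatCert v2 29fd7b4db6c99cf7): K2r0 BY NAME from
  -- the μ-free twin K2R0P♭ (PUB¹⁰ → FLAT → body; port-grade: PR04 Thm 7.3 at 2 via Kato 15.9) and the μ-input FLAT = (μ♭)_A
  -- (Perrin-Riou μ^± = 0 at p = 2 on the rank-0 CM members; open-problem grade class-wide, certificate-grade per class)
  have hCM : SignedMainConjectureCMTwoRankZero := hCMPf hBF hmod hLrat hGZK hPer2 hG1 hG2 hG3 hG4 hG5 hFlat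
  have hStr : SignedControlAtTwo := hStrP hG1 hG2 hG3 hG4 hG5
  intro W _ _ hcm hr hss ha hH
  obtain ⟨A, iA, iA', hAcm, hAr, hAss, hAa, hcong⟩ := hH
  have hL : W.entireLFunction 1 ≠ 0 := (W.analyticRank_eq_zero_iff_holds (hLrat W)).mp hr
  -- the CM partner's analytic data: newform, period ratio, a Pollack pair at 2 (needs L(A,1) ≠ 0)
  have hLA : A.entireLFunction 1 ≠ 0 := (A.analyticRank_eq_zero_iff_holds (hLrat A)).mp hAr
  haveI : NeZero (A.conductorNorm ℤ) := ⟨(A.conductorNorm_pos_holds).ne'⟩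
  obtain ⟨DmA⟩ := hmod A
  obtain ⟨ϖA, hϖApos, hϖAeq, hΩApos⟩ := DmA.exists_rat_mul_realPeriodRat_eq_plusPeriod
  obtain ⟨LsA, LfA, hSPA, hPPA⟩ :=
    Summit.BirchSwinnertonDyer.BirchSwinnertonDyer.Theorems.exists_isPollackPair_two DmA.isNewformOf hAss.1 hAa hLA
  -- K2r0 (rev 13): the CM partner's signed structure + main conjecture at 2, asked ONLY at analytic rank 0
  obtain ⟨hmuA, hMCA⟩ := hCM A hAcm hAr hAss hAa
  have hMC : Summit.BirchSwinnertonDyer.Rank1Residual.Supersingular.KobayashiMainConjecture W 2 1 :=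
    hK1P hG1 hG2 hG3 hG5 hGZK hMTt W A hcm hr hss ha hAcm hAr hAss hAa hcong DmA.f DmA.isNewformOf ϖA hϖAeq LsA LfA hPPA hmuA hMCA
      (hKato W hcm hr hss ha)
  obtain ⟨h12, hKim⟩ := hStr W hcm hr hss ha
  exact Summit.BirchSwinnertonDyer.BirchSwinnertonDyer.Theorems.bsdp_two_of_kobayashiMainConjecture_two_of_frobeniusTrace_eq_zero
    W hmod hGZK hss.1 ha hL h12 hKim hMC

end Summit.BirchSwinnertonDyer.BirchSwinnertonDyer.Theses.ThetaPartnerAtTwo
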